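/-
Copyright (c) 2026 the pub-hodgecm-mathlib formalisation cell (harness21).  Prover seat hodgecm-mathlib-F0P3a-p08 (g21): road «S3-ram» (LEAD F0P3a-plan (g13);
owner ∕ (α) keeper F0P3a-p06 (g16); (Cnt2′) chair F0P3a-p07 (g15) RULING (13)(6): `stub_Zhyp` composition pen), organ «(K5-B-J) KIND COUNTS OF THE HYPERBOLIC ROOT
REGION IN JUNCTION CURRENCY», FILE 3: the two SHELL kind counts at odd `N` in closed form (CM dress); 2026-09-02.
-/
import Literature.NumberTheory.Rogawski1990.TypeTwoRamifiedHyperbolicRegionKinds   -- ★ (this seat) FILE 2: §1 label transport (`ncard_selfDual_fixed_centredShell_[not_]class_conj_eq`), brings FILE 1 + ★ A-p19 FILES 1–4 + ★ A-p12 WSideBalls + ★ p05 IX ∕ X + ★ chair dictionary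
import HarnessLib

/-!
# The KIND COUNTS of the regime-B hyperbolic root region in junction currency, III: the SHELL counts (big ∕ small) at `N = 2n+1`, in closed form (CM dress)
# (Kottwitz 1986 §3; Rogawski 1990 §4.9; Labesse–Langlands 1979 §2; Bruhat–Tits 1972 §10)

Topic `NumberTheory/Rogawski1990`; namespace `Literature.NumberTheory.Rogawski1990.BlockLawHyp`.  THEOREMS ONLY (no definition, no instance, no notation, no named fact,
no `sorry`); kernel lane `--supports stmt-HodgeConjecture-24833`.  Cell `pub/hodgecm-mathlib` (D-0151), crux H413; road «S3-ram» (count-neutral); the (α) BLOCK-LAW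
skeleton (keeper F0P3a-p06 (g16) v2.3, chair F0P3a-p07 (g15) RULINGS (13)–(17)), regime-B hyperbolic cells `stub_Zhyp_{zero,pm}_{even,odd}_B` (this seat, composition pen):
the KIND MULTIPLICITIES `n₁ = n_small` (`¬Pin ∧ ¬Qbig`) and `n₂ = n_big` (`¬Pin ∧ Qbig`) of (4a) ★ `regionCensus_block_of_kindCounts` (F0P3-p03 (g16)) over the root region of
`γ = ι(B₀, 1)`, `B₀ = k⁻¹·(s·ĝ_w)·k` (★ A-p19 (g29) FILES 1–4), kinds = A-p12 (g25)'s frozen tokens (05:14:32Z), at `N = 2n+1`, regime B (`m = 2k′ + 3 < N`, `n = a + k′ + 1`,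
`q = #(𝓞_{L⁺}∕v)`): **`ncard_rootRegion_shellBig_hyperbolic_of_odd_B_ram`, `ncard_rootRegion_shellSmall_hyperbolic_of_odd_B_ram`** — `n_big = n_small = q^a`.
ROUTE (as FILE 2's inner count): FILE 1 ★ `ncard_rootRegion_shell_[not_]class_eq_ncard_two` reads the kind on the `W`-block of `B₀`; the plain level-`m` token is the centred one
(★ A-p12 `selfDual_fixed_lev_eq_ball_of_le`, `|½tr B₀ − 1| = |ϖ|^m` = chair dictionary clause (B)); FILE 2 §1 moves the label along `B ↦ k·B` to `s·ĝ_w` (class constant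
`t₀ = (ϖ^m)⁻¹(½tr B₀ − 1)` unchanged); the odd centred scale `ϖ^m = ϖ^(2(k′+1)+1)` collapses to `ϖ^(2(k′+1))` (★ A-p12 `selfDual_fixed_ball_odd_scale_eq`, `s·ĝ_w` unitary and
2-deep); the result is p05 (g18)'s centred shell `Sh_{k′+1}` with the centred class `CLS^c(t₀)`, read at the pulled-back element `γ₂′ := (localNonsplitEquiv …).symm ⟨s·ĝ_w, _⟩`
(`hcD : |½tr(s·ĝ_w) − 1| ≤ |ϖ|^m` since `s·û_w = 1`): ★ p05 `ncard_selfDual_fixed_centredShell_class_eq_pow_of_odd_depth_ramified` + `setOf_…_not_class_eq_class_mul_of_odd_depth_ramified`.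
HONEST LABEL: HC_CM is proved only modulo the 2 remaining named inputs (hLiu418 24832, h413 24833) until rung 0 closes; nothing printed is asserted here (lattice bookkeeping
over ★ results); «S3-ram» has no books consequence.

## References
* [Kottwitz1986] R. E. Kottwitz, *Base change for unit elements of Hecke algebras*, Compositio Math. 60 (1986), §3 (counting fixed lattices shell by shell).
* [Rogawski1990] J. D. Rogawski, *Automorphic Representations of Unitary Groups in Three Variables*, Ann. of Math. Stud. 123 (1990), §4.9 pp. 54–56, Lemma 4.9.3.
* [LabesseLanglands1979] J.-P. Labesse, R. P. Langlands, *L-indistinguishability for SL(2)*, Canad. J. Math. 31 (1979), §2 Lemma 2.1 p. 8.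
* [BruhatTits1972] F. Bruhat, J. Tits, *Groupes réductifs sur un corps local I*, Publ. Math. IHÉS 41 (1972), §10.
-/

set_option autoImplicit false

noncomputable section

open scoped Valued WithZero Matrix MatrixGroups
open Polynomial NumberField IsDedekindDomain
open Literature.NumberTheory.Automorphic Literature.NumberTheory.Automorphic.HermitianLattice Literature.NumberTheory.Automorphic.UnitaryLatticeTree
open Literature.NumberTheory.Automorphic.UnitaryGroup Literature.NumberTheory.GaloisRepresentations
open Literature.NumberTheory.Rogawski1990

namespace Literature.NumberTheory.Rogawski1990.BlockLawHyp

variable (L : Type) [Field L] [NumberField L] [IsCMField L] {v : HeightOneSpectrum (𝓞 ↥(maximalRealSubfield L))}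
  (w : PlacesOver L v) (hw : IsCMField.complexConj L • w.1 = w.1)

set_option maxHeartbeats 1600000 in
-- budget only: statement-heavy CM lattice tokens.
/-- **THE SHELL KIND COUNT OF THE HYPERBOLIC ROOT REGION, BIG (centred class of `t₀` present), `N = 2 * n + 1`, REGIME B** (`m = 2k′ + 3 < N`, `n = a + k′ + 1`): `n = q^a` (the outermost shell of the `W`-ball at odd `N`, halved by the centred class).
FILE 1 ∘ ★ A-p12 `selfDual_fixed_lev_eq_ball_of_le` (plain → centred on `B₀`) ∘ §1 transport `B ↦ k·B` to `s·ĝ_w` ∘ ★ A-p12 `selfDual_fixed_ball_odd_scale_eq` ∘ ★ p05 `ncard_selfDual_fixed_centredShell_class_eq_pow_of_odd_depth_ramified`, read at the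
pulled-back element `γ₂′ = (localNonsplitEquiv …).symm ⟨s·ĝ_w, _⟩`. [cite: Kottwitz1986, §3] [cite: Rogawski1990, §4.9 Lemma 4.9.3] [cite: LabesseLanglands1979, §2 Lemma 2.1 p. 8] [cite: BruhatTits1972, §10] -/
theorem ncard_rootRegion_shellBig_hyperbolic_of_odd_B_ram (he : v.asIdeal.ramificationIdx' w.1.asIdeal ≠ 1)
    (h2 : IsUnit (2 : (ValuativeRel.valuation (w.1.adicCompletion L)).integer))
    (ϖ : w.1.adicCompletion L) (hϖ : Valued.v ϖ = WithZero.exp (-1 : ℤ)) (hσϖ : galAdicCompletionMap (L := L) (IsCMField.complexConj L) hw ϖ = -ϖ)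
    (γH : (cmDatum L 2 (Matrix.of fun i j : Fin 2 => if i.val + j.val + 1 = 2 then (1 : L) else 0)).Local v × (cmDatum L 1 (Matrix.of fun i j : Fin 1 => if i.val + j.val + 1 = 1 then (1 : L) else 0)).Local v)
    (hblk : ∀ i j : Fin 2, Valued.v (((((γH.1.val : GL (Fin 2) (UnitaryGroup.LocalRing L v)).val.map (Pi.evalRingHom (fun w' : PlacesOver L v => w'.1.adicCompletion L) w))) - 1) i j) ≤ Valued.v (ϖ ^ 2))
    (hu2 : Valued.v (finGammaTwo L v γH w - 1) ≤ Valued.v (ϖ ^ 2))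
    (hirr : ¬ ∃ x : (w.1.adicCompletion L), (((((γH.1.val : GL (Fin 2) (UnitaryGroup.LocalRing L v)).val.map (Pi.evalRingHom (fun w' : PlacesOver L v => w'.1.adicCompletion L) w)))).charpoly).IsRoot x)
    {n : ℕ}
    (hdisc : Valued.v (((((γH.1.val : GL (Fin 2) (UnitaryGroup.LocalRing L v)).val.map (Pi.evalRingHom (fun w' : PlacesOver L v => w'.1.adicCompletion L) w)))).trace ^ 2 - 4 * ((((γH.1.val : GL (Fin 2) (UnitaryGroup.LocalRing L v)).val.map (Pi.evalRingHom (fun w' : PlacesOver L v => w'.1.adicCompletion L) w)))).det) = WithZero.exp (-((2 * (2 * n + 1) : ℕ) : ℤ)))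
    (m : ℕ) (hm : Valued.v (((finCharpolyTwo L v γH).eval (finGammaTwo L v γH)) w) =
      Valued.v ((toPlace v w (HeckeCharacter.uniformizer ↥(maximalRealSubfield L) v : v.adicCompletion ↥(maximalRealSubfield L))) ^ m))
    (β : (v.adicCompletion ↥(maximalRealSubfield L))ˣ)
    (hβ : toPlace v w (β : v.adicCompletion ↥(maximalRealSubfield L)) =
      -(((finCharpolyTwo L v γH).eval (finGammaTwo L v γH)) w *
          (finGammaTwo L v γH w ^ 2 + ((γH.1.val.val : Matrix (Fin 2) (Fin 2) (LocalRing L v)).map (Pi.evalRingHom (fun w' : PlacesOver L v => w'.1.adicCompletion L) w)).det)) /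
        (2 * finGammaTwo L v γH w ^ 2 * ((γH.1.val.val : Matrix (Fin 2) (Fin 2) (LocalRing L v)).map (Pi.evalRingHom (fun w' : PlacesOver L v => w'.1.adicCompletion L) w)).det))
    (s : (w.1.adicCompletion L)ˣ)
    (hs : (s : w.1.adicCompletion L) * (((localNonsplitEquiv (IsCMField.complexConj L) (Matrix.of fun i j : Fin 1 => if i.val + j.val + 1 = 1 then (1 : L) else 0) (IsCMField.complexConj_ne_one L) w hw γH.2).val : GL (Fin 1) (w.1.adicCompletion L)) : Matrix (Fin 1) (Fin 1) (w.1.adicCompletion L)) 0 0 = 1)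
    (k : GL (Fin 2) (w.1.adicCompletion L))
    (hk : k ∈ unitaryGroupOfForm (galAdicCompletionMap (L := L) (IsCMField.complexConj L) hw) (placeForm (Matrix.of fun i j : Fin 2 => if i.val + j.val + 1 = 2 then (1 : L) else 0) w.1))
    (γ : unitaryGroupOfForm (galAdicCompletionMap (L := L) (IsCMField.complexConj L) hw) ((StdForm.antidiagonal 3).over (w.1.adicCompletion L)))
    (hγ : (γ : GL (Fin 3) (w.1.adicCompletion L)) = endoGL ((k⁻¹ * (Matrix.GeneralLinearGroup.scalar (Fin 2) s * ((localNonsplitEquiv (IsCMField.complexConj L) (Matrix.of fun i j : Fin 2 => if i.val + j.val + 1 = 2 then (1 : L) else 0) (IsCMField.complexConj_ne_one L) w hw γH.1).val : GL (Fin 2) (w.1.adicCompletion L))) * k), (1 : GL (Fin 1) (w.1.adicCompletion L))))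
    (k' a : ℕ) (hmk : m = 2 * k' + 3) (hna : n = a + k' + 1) (hlt : m < 2 * n + 1)
    (ε : (w.1.adicCompletion L)) (hεv : Valued.v ε = 1) (hε : ∀ z : (w.1.adicCompletion L), Valued.v z ≤ 1 → Valued.v (z ^ 2 - ε) = 1) :
    {x : {M : Submodule (Valued.integer (w.1.adicCompletion L)) (Fin 3 → (w.1.adicCompletion L)) // IsVertex (galAdicCompletionMap (L := L) (IsCMField.complexConj L) hw) ϖ ((StdForm.antidiagonal 3).over (w.1.adicCompletion L)) M} | x ∈ {x : {M : Submodule (Valued.integer (w.1.adicCompletion L)) (Fin 3 → (w.1.adicCompletion L)) // IsVertex (galAdicCompletionMap (L := L) (IsCMField.complexConj L) hw) ϖ ((StdForm.antidiagonal 3).over (w.1.adicCompletion L)) M} | latticeGraphIso (galAdicCompletionMap (L := L) (IsCMField.complexConj L) hw) ϖ ((StdForm.antidiagonal 3).over (w.1.adicCompletion L)) γ x = x ∧ IsSelfDualLattice (galAdicCompletionMap (L := L) (IsCMField.complexConj L) hw) ϖ ((StdForm.antidiagonal 3).over (w.1.adicCompletion L)) x.1 ∧ x.1.map ((Matrix.toLin'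 (((γ : GL (Fin 3) (w.1.adicCompletion L)) : Matrix (Fin 3) (Fin 3) (w.1.adicCompletion L)) - 1)).restrictScalars (Valued.integer (w.1.adicCompletion L))) ≤ scaleLattice (ϖ ^ m) x.1} ∧ ¬ (∀ y ∈ x.1, y 1 = 0 → ((((γ : GL (Fin 3) (w.1.adicCompletion L)) : Matrix (Fin 3) (Fin 3) (w.1.adicCompletion L)) - ((((k⁻¹ * (Matrix.GeneralLinearGroup.scalar (Fin 2) s * ((localNonsplitEquiv (IsCMField.complexConj L) (Matrix.of fun i j : Fin 2 => if i.val + j.val + 1 = 2 then (1 : L) else 0) (IsCMField.complexConj_ne_one L) w hw γH.1).val : GL (Fin 2) (w.1.adicCompletion L))) * k) : GL (Fin 2) (w.1.adicCompletion L)) : Matrix (Fin 2) (Fin 2) (w.1.adicCompletion L)).trace / 2) • (1 : Matrix (Fin 3) (Fin 3) (w.1.adicCompletion L))) *ᵥ y) ∈ scaleLattice (ϖ ^ (m + 1)) x.1) ∧ (∃ y ∈ x.1, y 1 = 0 ∧ ∃ a : (w.1.adicCompletion L), Valued.v a = 1 ∧ Valued.v ((ϖ ^ m)⁻¹ * pairing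 (galAdicCompletionMap (L := L) (IsCMField.complexConj L) hw) ((StdForm.antidiagonal 3).over (w.1.adicCompletion L)) y ((((γ : GL (Fin 3) (w.1.adicCompletion L)) : Matrix (Fin 3) (Fin 3) (w.1.adicCompletion L)) - ((((k⁻¹ * (Matrix.GeneralLinearGroup.scalar (Fin 2) s * ((localNonsplitEquiv (IsCMField.complexConj L) (Matrix.of fun i j : Fin 2 => if i.val + j.val + 1 = 2 then (1 : L) else 0) (IsCMField.complexConj_ne_one L) w hw γH.1).val : GL (Fin 2) (w.1.adicCompletion L))) * k) : GL (Fin 2) (w.1.adicCompletion L)) : Matrix (Fin 2) (Fin 2) (w.1.adicCompletion L)).trace / 2) • (1 : Matrix (Fin 3) (Fin 3) (w.1.adicCompletion L))) *ᵥ y) - ((ϖ ^ m)⁻¹ * ((((k⁻¹ * (Matrix.GeneralLinearGroup.scalar (Fin 2) s * ((localNonsplitEquiv (IsCMField.complexConj L) (Matrix.of fun i j : Fin 2 => if i.val + j.val + 1 = 2 then (1 : L) else 0) (IsCMField.complexConj_ne_one L) w hw γH.1).val : GL (Fin 2) (w.1.adicCompletion L))) * k) : GL (Fin 2) (w.1.adicCompletion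 L)) : Matrix (Fin 2) (Fin 2) (w.1.adicCompletion L)).trace / 2 - 1)) * a ^ 2) < 1)}.ncard = Nat.card (𝓞 ↥(maximalRealSubfield L) ⧸ v.asIdeal) ^ a := by
  haveI := isPrincipalIdealRing_integer_adicCompletion L v w
  have hϖ0 : ϖ ≠ 0 := fun h0 => by rw [h0, map_zero] at hϖ; exact WithZero.coe_ne_zero hϖ.symm
  have hϖlt : Valued.v ϖ < 1 := by rw [hϖ, ← WithZero.exp_zero]; exact WithZero.exp_lt_exp.2 (by norm_num)
  have hϖ1 : Valued.v ϖ ≤ 1 := hϖlt.le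
  have hvϖ0 : 0 < Valued.v ϖ := by rw [hϖ]; exact WithZero.exp_pos
  have h2w : Valued.v (2 : (w.1.adicCompletion L)) = 1 := (isUnit_two_integer_iff_valued_eq_one L w.1).1 h2
  have hσσ : ∀ z : (w.1.adicCompletion L), (galAdicCompletionMap (L := L) (IsCMField.complexConj L) hw) ((galAdicCompletionMap (L := L) (IsCMField.complexConj L) hw) z) = z :=
    galAdicCompletionMap_galAdicCompletionMap_of_smul_eq (IsCMField.complexConj L) w (IsCMField.complexConj_ne_one L) hw
  have hvσ : ∀ z : (w.1.adicCompletion L), Valued.v ((galAdicCompletionMap (L := L) (IsCMField.complexConj L) hw) z) = Valued.v z := fun z => valued_galAdicCompletionMap (L := L) (IsCMField.complexConj L) hw z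
  have hsv : Valued.v (s : (w.1.adicCompletion L)) = 1 := by
    have h := congrArg Valued.v hs
    rwa [map_mul, v_oneByOne_eq_one_of_local L w hw γH.2, mul_one, map_one] at h
  have hk' : k ∈ unitaryGroupOfForm (galAdicCompletionMap (L := L) (IsCMField.complexConj L) hw) (!![(0 : (w.1.adicCompletion L)), 1; 1, 0] : Matrix (Fin 2) (Fin 2) (w.1.adicCompletion L)) := by
    rw [← stdForm_antidiagonal_two_over_eq, ← placeForm_antidiagOne]; exact hk
  -- THM 1's value gap `|det(B₀ − 1)| = |ϖ|^(2m) > |ϖ|^(2m+1)` (★ A-p19 FILE 4)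
  have hdet : Valued.v ϖ ^ (2 * m + 1) < Valued.v ((((k⁻¹ * (Matrix.GeneralLinearGroup.scalar (Fin 2) s * ((localNonsplitEquiv (IsCMField.complexConj L) (Matrix.of fun i j : Fin 2 => if i.val + j.val + 1 = 2 then (1 : L) else 0) (IsCMField.complexConj_ne_one L) w hw γH.1).val : GL (Fin 2) (w.1.adicCompletion L))) * k) : GL (Fin 2) (w.1.adicCompletion L)) : Matrix (Fin 2) (Fin 2) (w.1.adicCompletion L)) - (1 : Matrix (Fin 2) (Fin 2) (w.1.adicCompletion L))).det := by
    rw [v_det_rerootedCentred_sub_one_eq_ram L w hw he ϖ hϖ γH m hm s hs k]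
    exact pow_lt_pow_right_of_lt_one₀ hvϖ0 hϖlt (by omega)
  -- the chair's dictionary, regime B: `|2û₀₀ − tr ĝ_w| = |ϖ^m|`
  obtain ⟨-, hB, -⟩ := typeTwo_depthDictionary_odd_ram L w hw he h2 ϖ hϖ hσϖ hblk hu2 hirr hdisc m hm β hβ
  have hsc := (hB hlt).2.2.2
  -- FILE 1: the shell kind on the `W`-block of `B₀`
  rw [ncard_rootRegion_shell_class_eq_ncard_two hσσ hvσ hϖ γ _ hγ hdet]
  -- the plain level-`m` token of `B₀` is its centred one (A-p12 §3 at `Γ := B₀`; `|½tr B₀ − 1| = |ϖ^m|`)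
  have hck : Valued.v ((((k⁻¹ * (Matrix.GeneralLinearGroup.scalar (Fin 2) s * ((localNonsplitEquiv (IsCMField.complexConj L) (Matrix.of fun i j : Fin 2 => if i.val + j.val + 1 = 2 then (1 : L) else 0) (IsCMField.complexConj_ne_one L) w hw γH.1).val : GL (Fin 2) (w.1.adicCompletion L))) * k) : GL (Fin 2) (w.1.adicCompletion L)) : Matrix (Fin 2) (Fin 2) (w.1.adicCompletion L)).trace / 2 - 1) ≤ Valued.v (((Units.mk0 ϖ hϖ0 : (w.1.adicCompletion L)ˣ) : (w.1.adicCompletion L)) ^ m) := by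
    rw [trace_coe_inv_conj_scalar_mul, mul_div_assoc, v_mul_trace_div_two_sub_one_eq h2w hs hsv, Units.val_mk0, coe_localNonsplitEquiv_apply]
    exact hsc.le
  have e := selfDual_fixed_lev_eq_ball_of_le L v w hw he h2 (Units.mk0 ϖ hϖ0) (ϖ' := ϖ) _ m hck
  simp only [Units.val_mk0] at e
  -- (2) the plain level-`m` token is the centred one
  have hswap : {B : Submodule (Valued.integer (w.1.adicCompletion L)) (Fin 2 → (w.1.adicCompletion L)) | IsSelfDualLattice (galAdicCompletionMap (L := L) (IsCMField.complexConj L) hw) ϖ (!![(0 : (w.1.adicCompletion L)), 1; 1, 0] : Matrix (Fin 2) (Fin 2) (w.1.adicCompletion L)) B ∧ mapGL (k⁻¹ * (Matrix.GeneralLinearGroup.scalar (Fin 2) s * ((localNonsplitEquiv (IsCMField.complexConj L) (Matrix.of fun i j : Fin 2 => if i.val + j.val + 1 = 2 then (1 : L) else 0) (IsCMField.complexConj_ne_one L) w hw γH.1).val : GL (Fin 2) (w.1.adicCompletion L))) * k) B = B ∧ (B.map ((Matrix.toLin' ((((k⁻¹ * (Matrix.GeneralLinearGroup.scalar (Fin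 2) s * ((localNonsplitEquiv (IsCMField.complexConj L) (Matrix.of fun i j : Fin 2 => if i.val + j.val + 1 = 2 then (1 : L) else 0) (IsCMField.complexConj_ne_one L) w hw γH.1).val : GL (Fin 2) (w.1.adicCompletion L))) * k) : GL (Fin 2) (w.1.adicCompletion L)) : Matrix (Fin 2) (Fin 2) (w.1.adicCompletion L)) - 1)).restrictScalars (Valued.integer (w.1.adicCompletion L))) ≤ scaleLattice (ϖ ^ m) B ∧ ¬ B.map ((Matrix.toLin' ((((k⁻¹ * (Matrix.GeneralLinearGroup.scalar (Fin 2) s * ((localNonsplitEquiv (IsCMField.complexConj L) (Matrix.of fun i j : Fin 2 => if i.val + j.val + 1 = 2 then (1 : L) else 0) (IsCMField.complexConj_ne_one L) w hw γH.1).val : GL (Fin 2) (w.1.adicCompletion L))) * k) : GL (Fin 2) (w.1.adicCompletion L)) : Matrix (Fin 2) (Fin 2) (w.1.adicCompletion L)) - ((((k⁻¹ * (Matrix.GeneralLinearGroup.scalar (Fin 2) s * ((localNonsplitEquiv (IsCMField.complexConj L) (Matrix.of fun i j : Fin 2 => if i.val + j.val + 1 = 2 then (1 : L) else 0) (IsCMField.complexConj_ne_one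 L) w hw γH.1).val : GL (Fin 2) (w.1.adicCompletion L))) * k) : GL (Fin 2) (w.1.adicCompletion L)) : Matrix (Fin 2) (Fin 2) (w.1.adicCompletion L)).trace / 2) • (1 : Matrix (Fin 2) (Fin 2) (w.1.adicCompletion L)))).restrictScalars (Valued.integer (w.1.adicCompletion L))) ≤ scaleLattice (ϖ ^ (m + 1)) B ∧ ∃ y₂ ∈ B, ∃ a : (w.1.adicCompletion L), Valued.v a = 1 ∧ Valued.v ((ϖ ^ m)⁻¹ * pairing (galAdicCompletionMap (L := L) (IsCMField.complexConj L) hw) (!![(0 : (w.1.adicCompletion L)), 1; 1, 0] : Matrix (Fin 2) (Fin 2) (w.1.adicCompletion L)) y₂ (((((k⁻¹ * (Matrix.GeneralLinearGroup.scalar (Fin 2) s * ((localNonsplitEquiv (IsCMField.complexConj L) (Matrix.of fun i j : Fin 2 => if i.val + j.val + 1 = 2 then (1 : L) else 0) (IsCMField.complexConj_ne_one L) w hw γH.1).val : GL (Fin 2) (w.1.adicCompletion L))) * k) : GL (Fin 2) (w.1.adicCompletion L)) : Matrix (Fin 2) (Fin 2) (w.1.adicCompletion L)) - ((((k⁻¹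 * (Matrix.GeneralLinearGroup.scalar (Fin 2) s * ((localNonsplitEquiv (IsCMField.complexConj L) (Matrix.of fun i j : Fin 2 => if i.val + j.val + 1 = 2 then (1 : L) else 0) (IsCMField.complexConj_ne_one L) w hw γH.1).val : GL (Fin 2) (w.1.adicCompletion L))) * k) : GL (Fin 2) (w.1.adicCompletion L)) : Matrix (Fin 2) (Fin 2) (w.1.adicCompletion L)).trace / 2) • (1 : Matrix (Fin 2) (Fin 2) (w.1.adicCompletion L))) *ᵥ y₂) - ((ϖ ^ m)⁻¹ * ((((k⁻¹ * (Matrix.GeneralLinearGroup.scalar (Fin 2) s * ((localNonsplitEquiv (IsCMField.complexConj L) (Matrix.of fun i j : Fin 2 => if i.val + j.val + 1 = 2 then (1 : L) else 0) (IsCMField.complexConj_ne_one L) w hw γH.1).val : GL (Fin 2) (w.1.adicCompletion L))) * k) : GL (Fin 2) (w.1.adicCompletion L)) : Matrix (Fin 2) (Fin 2) (w.1.adicCompletion L)).trace / 2 - 1)) * a ^ 2) < 1)} =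
      {B : Submodule (Valued.integer (w.1.adicCompletion L)) (Fin 2 → (w.1.adicCompletion L)) | IsSelfDualLattice (galAdicCompletionMap (L := L) (IsCMField.complexConj L) hw) ϖ (!![(0 : (w.1.adicCompletion L)), 1; 1, 0] : Matrix (Fin 2) (Fin 2) (w.1.adicCompletion L)) B ∧ mapGL (k⁻¹ * (Matrix.GeneralLinearGroup.scalar (Fin 2) s * ((localNonsplitEquiv (IsCMField.complexConj L) (Matrix.of fun i j : Fin 2 => if i.val + j.val + 1 = 2 then (1 : L) else 0) (IsCMField.complexConj_ne_one L) w hw γH.1).val : GL (Fin 2) (w.1.adicCompletion L))) * k) B = B ∧ (B.map ((Matrix.toLin' ((((k⁻¹ * (Matrix.GeneralLinearGroup.scalar (Fin 2) s * ((localNonsplitEquiv (IsCMField.complexConj L) (Matrix.of fun i j : Fin 2 => if i.val + j.val + 1 = 2 then (1 : L) else 0) (IsCMField.complexConj_ne_one L) w hw γH.1).val : GL (Fin 2) (w.1.adicCompletion L))) * k) : GL (Fin 2) (w.1.adicCompletion L)) : Matrix (Fin 2) (Fin 2) (w.1.adicCompletion L)) - ((((k⁻¹ * (Matrix.GeneralLinearGroup.scalar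 (Fin 2) s * ((localNonsplitEquiv (IsCMField.complexConj L) (Matrix.of fun i j : Fin 2 => if i.val + j.val + 1 = 2 then (1 : L) else 0) (IsCMField.complexConj_ne_one L) w hw γH.1).val : GL (Fin 2) (w.1.adicCompletion L))) * k) : GL (Fin 2) (w.1.adicCompletion L)) : Matrix (Fin 2) (Fin 2) (w.1.adicCompletion L)).trace / 2) • (1 : Matrix (Fin 2) (Fin 2) (w.1.adicCompletion L)))).restrictScalars (Valued.integer (w.1.adicCompletion L))) ≤ scaleLattice (ϖ ^ m) B ∧ ¬ B.map ((Matrix.toLin' ((((k⁻¹ * (Matrix.GeneralLinearGroup.scalar (Fin 2) s * ((localNonsplitEquiv (IsCMField.complexConj L) (Matrix.of fun i j : Fin 2 => if i.val + j.val + 1 = 2 then (1 : L) else 0) (IsCMField.complexConj_ne_one L) w hw γH.1).val : GL (Fin 2) (w.1.adicCompletion L))) * k) : GL (Fin 2) (w.1.adicCompletion L)) : Matrix (Fin 2) (Fin 2) (w.1.adicCompletion L)) - ((((k⁻¹ * (Matrix.GeneralLinearGroup.scalar (Fin 2) s * ((localNonsplitEquiv (IsCMField.complexConj L) (Matrix.of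 fun i j : Fin 2 => if i.val + j.val + 1 = 2 then (1 : L) else 0) (IsCMField.complexConj_ne_one L) w hw γH.1).val : GL (Fin 2) (w.1.adicCompletion L))) * k) : GL (Fin 2) (w.1.adicCompletion L)) : Matrix (Fin 2) (Fin 2) (w.1.adicCompletion L)).trace / 2) • (1 : Matrix (Fin 2) (Fin 2) (w.1.adicCompletion L)))).restrictScalars (Valued.integer (w.1.adicCompletion L))) ≤ scaleLattice (ϖ ^ (m + 1)) B ∧ ∃ y₂ ∈ B, ∃ a : (w.1.adicCompletion L), Valued.v a = 1 ∧ Valued.v ((ϖ ^ m)⁻¹ * pairing (galAdicCompletionMap (L := L) (IsCMField.complexConj L) hw) (!![(0 : (w.1.adicCompletion L)), 1; 1, 0] : Matrix (Fin 2) (Fin 2) (w.1.adicCompletion L)) y₂ (((((k⁻¹ * (Matrix.GeneralLinearGroup.scalar (Fin 2) s * ((localNonsplitEquiv (IsCMField.complexConj L) (Matrix.of fun i j : Fin 2 => if i.val + j.val + 1 = 2 then (1 : L) else 0) (IsCMField.complexConj_ne_one L) w hw γH.1).val : GL (Fin 2) (w.1.adicCompletion L))) * k) : GL (Fin 2) (w.1.adicCompletion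 L)) : Matrix (Fin 2) (Fin 2) (w.1.adicCompletion L)) - ((((k⁻¹ * (Matrix.GeneralLinearGroup.scalar (Fin 2) s * ((localNonsplitEquiv (IsCMField.complexConj L) (Matrix.of fun i j : Fin 2 => if i.val + j.val + 1 = 2 then (1 : L) else 0) (IsCMField.complexConj_ne_one L) w hw γH.1).val : GL (Fin 2) (w.1.adicCompletion L))) * k) : GL (Fin 2) (w.1.adicCompletion L)) : Matrix (Fin 2) (Fin 2) (w.1.adicCompletion L)).trace / 2) • (1 : Matrix (Fin 2) (Fin 2) (w.1.adicCompletion L))) *ᵥ y₂) - ((ϖ ^ m)⁻¹ * ((((k⁻¹ * (Matrix.GeneralLinearGroup.scalar (Fin 2) s * ((localNonsplitEquiv (IsCMField.complexConj L) (Matrix.of fun i j : Fin 2 => if i.val + j.val + 1 = 2 then (1 : L) else 0) (IsCMField.complexConj_ne_one L) w hw γH.1).val : GL (Fin 2) (w.1.adicCompletion L))) * k) : GL (Fin 2) (w.1.adicCompletion L)) : Matrix (Fin 2) (Fin 2) (w.1.adicCompletion L)).trace / 2 - 1)) * a ^ 2) < 1)} := by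
    ext B
    simp only [Set.mem_setOf_eq]
    constructor
    · rintro ⟨hSD, hfix, hl, hrest⟩; exact ⟨hSD, hfix, ((Set.ext_iff.1 e B).1 ⟨hSD, hfix, hl⟩).2.2, hrest⟩
    · rintro ⟨hSD, hfix, hl, hrest⟩; exact ⟨hSD, hfix, ((Set.ext_iff.1 e B).2 ⟨hSD, hfix, hl⟩).2.2, hrest⟩
  rw [hswap]
  -- (3) transport `B ↦ k·B` to `s·ĝ_w` (`k` is an isometry: the class constant `t₀` is unchanged)
  have t := ncard_selfDual_fixed_centredShell_class_conj_eq (galAdicCompletionMap (L := L) (IsCMField.complexConj L) hw) ϖ (!![(0 : (w.1.adicCompletion L)), 1; 1, 0] : Matrix (Fin 2) (Fin 2) (w.1.adicCompletion L)) (Subgroup.inv_mem _ hk') (Matrix.GeneralLinearGroup.scalar (Fin 2) s * ((localNonsplitEquiv (IsCMField.complexConj L) (Matrix.of fun i j : Fin 2 => if i.val + j.val + 1 = 2 then (1 : L) else 0) (IsCMField.complexConj_ne_one L) w hw γH.1).val : GL (Fin 2) (w.1.adicCompletion L))) (ϖ ^ m) (ϖ ^ (m + 1)) ((ϖ ^ m)⁻¹)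 ((ϖ ^ m)⁻¹ * ((((k⁻¹ * (Matrix.GeneralLinearGroup.scalar (Fin 2) s * ((localNonsplitEquiv (IsCMField.complexConj L) (Matrix.of fun i j : Fin 2 => if i.val + j.val + 1 = 2 then (1 : L) else 0) (IsCMField.complexConj_ne_one L) w hw γH.1).val : GL (Fin 2) (w.1.adicCompletion L))) * k) : GL (Fin 2) (w.1.adicCompletion L)) : Matrix (Fin 2) (Fin 2) (w.1.adicCompletion L)).trace / 2 - 1))
  simp only [inv_inv] at t
  rw [t]
  -- (4) `s·ĝ_w`: unitary, 2-deep, same discriminant depth, `|½tr(s·ĝ_w) − 1| = |ϖ^m|`; odd centred scale `ϖ^m` collapses to `ϖ^(2(k′+1))`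
  have hblk' : ∀ i j : Fin 2, Valued.v (((((localNonsplitEquiv (IsCMField.complexConj L) (Matrix.of fun i j : Fin 2 => if i.val + j.val + 1 = 2 then (1 : L) else 0) (IsCMField.complexConj_ne_one L) w hw γH.1).val : GL (Fin 2) (w.1.adicCompletion L)) : Matrix (Fin 2) (Fin 2) (w.1.adicCompletion L)) - 1) i j) ≤ Valued.v (ϖ ^ 2) := hblk
  have hirrG : ∀ x : (w.1.adicCompletion L), ¬ (((((localNonsplitEquiv (IsCMField.complexConj L) (Matrix.of fun i j : Fin 2 => if i.val + j.val + 1 = 2 then (1 : L) else 0) (IsCMField.complexConj_ne_one L) w hw γH.1).val : GL (Fin 2) (w.1.adicCompletion L)) : Matrix (Fin 2) (Fin 2) (w.1.adicCompletion L))).charpoly).IsRoot x := fun x hx => hirr ⟨x, hx⟩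
  have hdiscG : Valued.v (((((localNonsplitEquiv (IsCMField.complexConj L) (Matrix.of fun i j : Fin 2 => if i.val + j.val + 1 = 2 then (1 : L) else 0) (IsCMField.complexConj_ne_one L) w hw γH.1).val : GL (Fin 2) (w.1.adicCompletion L)) : Matrix (Fin 2) (Fin 2) (w.1.adicCompletion L))).trace ^ 2 - 4 * ((((localNonsplitEquiv (IsCMField.complexConj L) (Matrix.of fun i j : Fin 2 => if i.val + j.val + 1 = 2 then (1 : L) else 0) (IsCMField.complexConj_ne_one L) w hw γH.1).val : GL (Fin 2) (w.1.adicCompletion L)) : Matrix (Fin 2) (Fin 2) (w.1.adicCompletion L))).det) = WithZero.exp (-((2 * (2 * n + 1) : ℕ) : ℤ)) := hdisc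
  have hscG : Valued.v (2 * ((((localNonsplitEquiv (IsCMField.complexConj L) (Matrix.of fun i j : Fin 1 => if i.val + j.val + 1 = 1 then (1 : L) else 0) (IsCMField.complexConj_ne_one L) w hw γH.2).val : GL (Fin 1) (w.1.adicCompletion L))) : Matrix (Fin 1) (Fin 1) (w.1.adicCompletion L)) 0 0 - ((((localNonsplitEquiv (IsCMField.complexConj L) (Matrix.of fun i j : Fin 2 => if i.val + j.val + 1 = 2 then (1 : L) else 0) (IsCMField.complexConj_ne_one L) w hw γH.1).val : GL (Fin 2) (w.1.adicCompletion L)) : Matrix (Fin 2) (Fin 2) (w.1.adicCompletion L))).trace) = Valued.v (ϖ ^ m) := hsc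
  have hu00 : ((((localNonsplitEquiv (IsCMField.complexConj L) (Matrix.of fun i j : Fin 1 => if i.val + j.val + 1 = 1 then (1 : L) else 0) (IsCMField.complexConj_ne_one L) w hw γH.2).val : GL (Fin 1) (w.1.adicCompletion L))) : Matrix (Fin 1) (Fin 1) (w.1.adicCompletion L)) 0 0 = finGammaTwo L v γH w := rfl
  have huu : (galAdicCompletionMap (L := L) (IsCMField.complexConj L) hw) (finGammaTwo L v γH w) * finGammaTwo L v γH w = 1 := by
    have h := congrArg (fun y : LocalRing L v => y w) (conjLocal_finGammaTwo_mul_finGammaTwo L v γH)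
    simpa only [Pi.mul_apply, Pi.one_apply, conjLocal_apply_eq_galAdicCompletionMap L v w hw] using h
  have hs1 : (s : (w.1.adicCompletion L)) * finGammaTwo L v γH w = 1 := by rw [← hu00]; exact hs
  have hsnorm : (galAdicCompletionMap (L := L) (IsCMField.complexConj L) hw) (s : (w.1.adicCompletion L)) * (s : (w.1.adicCompletion L)) = 1 := norm_eq_one_of_mul_eq_one_of_norm_eq_one huu hs1
  have hGU : (Matrix.GeneralLinearGroup.scalar (Fin 2) s * ((localNonsplitEquiv (IsCMField.complexConj L) (Matrix.of fun i j : Fin 2 => if i.val + j.val + 1 = 2 then (1 : L) else 0) (IsCMField.complexConj_ne_one L) w hw γH.1).val : GL (Fin 2) (w.1.adicCompletion L))) ∈ unitaryGroupOfForm (galAdicCompletionMap (L := L) (IsCMField.complexConj L) hw) (placeForm (Matrix.of fun i j : Fin 2 => if i.val + j.val + 1 = 2 then (1 : L) else 0) w.1) := scalar_mul_mem_unitaryGroupOfForm (localNonsplitEquiv (IsCMField.complexConj L) (Matrix.of fun i j : Fin 2 => if i.val + j.val + 1 = 2 then (1 : L) else 0) (IsCMField.complexConj_ne_one L) w hw γH.1).2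 s hsnorm
  have hG2 : ∀ i j : Fin 2, Valued.v (((((Matrix.GeneralLinearGroup.scalar (Fin 2) s * ((localNonsplitEquiv (IsCMField.complexConj L) (Matrix.of fun i j : Fin 2 => if i.val + j.val + 1 = 2 then (1 : L) else 0) (IsCMField.complexConj_ne_one L) w hw γH.1).val : GL (Fin 2) (w.1.adicCompletion L))) : GL (Fin 2) (w.1.adicCompletion L)) : Matrix (Fin 2) (Fin 2) (w.1.adicCompletion L)) - 1) i j) ≤ Valued.v (ϖ ^ 2) := by
    intro i j
    have es : (s : (w.1.adicCompletion L)) • (((localNonsplitEquiv (IsCMField.complexConj L) (Matrix.of fun i j : Fin 2 => if i.val + j.val + 1 = 2 then (1 : L) else 0) (IsCMField.complexConj_ne_one L) w hw γH.1).val : GL (Fin 2) (w.1.adicCompletion L)) : Matrix (Fin 2) (Fin 2) (w.1.adicCompletion L)) - 1 = (s : (w.1.adicCompletion L)) • ((((localNonsplitEquiv (IsCMField.complexConj L) (Matrix.of fun i j : Fin 2 => if i.val + j.val + 1 = 2 then (1 : L) else 0) (IsCMField.complexConj_ne_one L) w hw γH.1).val : GL (Fin 2) (w.1.adicCompletion L))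 : Matrix (Fin 2) (Fin 2) (w.1.adicCompletion L)) - ((((localNonsplitEquiv (IsCMField.complexConj L) (Matrix.of fun i j : Fin 1 => if i.val + j.val + 1 = 1 then (1 : L) else 0) (IsCMField.complexConj_ne_one L) w hw γH.2).val : GL (Fin 1) (w.1.adicCompletion L))) : Matrix (Fin 1) (Fin 1) (w.1.adicCompletion L)) 0 0 • (1 : Matrix (Fin 2) (Fin 2) (w.1.adicCompletion L))) := by
      rw [smul_sub, smul_smul, hs, one_smul]
    rw [coe_scalar_mul_eq_smul, es, Matrix.smul_apply, smul_eq_mul, map_mul, hsv, one_mul]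
    have e1 : ((((localNonsplitEquiv (IsCMField.complexConj L) (Matrix.of fun i j : Fin 2 => if i.val + j.val + 1 = 2 then (1 : L) else 0) (IsCMField.complexConj_ne_one L) w hw γH.1).val : GL (Fin 2) (w.1.adicCompletion L)) : Matrix (Fin 2) (Fin 2) (w.1.adicCompletion L)) - ((((localNonsplitEquiv (IsCMField.complexConj L) (Matrix.of fun i j : Fin 1 => if i.val + j.val + 1 = 1 then (1 : L) else 0) (IsCMField.complexConj_ne_one L) w hw γH.2).val : GL (Fin 1) (w.1.adicCompletion L))) : Matrix (Fin 1) (Fin 1) (w.1.adicCompletion L)) 0 0 • (1 : Matrix (Fin 2) (Fin 2) (w.1.adicCompletion L))) i j = ((((localNonsplitEquiv (IsCMField.complexConj L) (Matrix.of fun i j : Fin 2 => if i.val + j.val + 1 = 2 then (1 : L) else 0) (IsCMField.complexConj_ne_one L) w hw γH.1).val : GL (Fin 2) (w.1.adicCompletion L)) : Matrix (Fin 2) (Fin 2) (w.1.adicCompletion L)) - 1) i j - (((((localNonsplitEquiv (IsCMField.complexConj L) (Matrix.of fun i j : Fin 1 => if i.val + j.val + 1 = 1 then (1 : L) else 0)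 (IsCMField.complexConj_ne_one L) w hw γH.2).val : GL (Fin 1) (w.1.adicCompletion L))) : Matrix (Fin 1) (Fin 1) (w.1.adicCompletion L)) 0 0 - 1) * (1 : Matrix (Fin 2) (Fin 2) (w.1.adicCompletion L)) i j := by
      simp only [Matrix.sub_apply, Matrix.smul_apply, smul_eq_mul]; ring
    rw [e1]
    refine le_trans (Valuation.map_sub _ _ _) (max_le (hblk' i j) ?_)
    rw [map_mul, hu00]
    by_cases hij : i = j
    · rw [hij, Matrix.one_apply_eq, map_one, mul_one]; exact hu2
    · rw [Matrix.one_apply_ne hij, map_zero, mul_zero]; exact zero_le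
  have hGN : Valued.v (((((Matrix.GeneralLinearGroup.scalar (Fin 2) s * ((localNonsplitEquiv (IsCMField.complexConj L) (Matrix.of fun i j : Fin 2 => if i.val + j.val + 1 = 2 then (1 : L) else 0) (IsCMField.complexConj_ne_one L) w hw γH.1).val : GL (Fin 2) (w.1.adicCompletion L))) : GL (Fin 2) (w.1.adicCompletion L)) : Matrix (Fin 2) (Fin 2) (w.1.adicCompletion L))).trace ^ 2 - 4 * ((((Matrix.GeneralLinearGroup.scalar (Fin 2) s * ((localNonsplitEquiv (IsCMField.complexConj L) (Matrix.of fun i j : Fin 2 => if i.val + j.val + 1 = 2 then (1 : L) else 0) (IsCMField.complexConj_ne_one L) w hw γH.1).val : GL (Fin 2) (w.1.adicCompletion L))) : GL (Fin 2) (w.1.adicCompletion L)) : Matrix (Fin 2) (Fin 2) (w.1.adicCompletion L))).det) = WithZero.exp (-((2 * (2 * n + 1) : ℕ) : ℤ)) := by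
    rw [coe_scalar_mul_eq_smul, v_trace_sq_sub_four_mul_det_smul hsv]; exact hdiscG
  have e2 := selfDual_fixed_ball_odd_scale_eq L v w hw he h2 (Units.mk0 ϖ hϖ0) hϖ hσϖ (ϖ' := ϖ) _ hGU hG2 (N := 2 * n + 1) hGN (j := k' + 1) (by omega)
  simp only [Units.val_mk0] at e2
  rw [show 2 * (k' + 1) + 1 = m by omega] at e2
  have hswap2 : {B : Submodule (Valued.integer (w.1.adicCompletion L)) (Fin 2 → (w.1.adicCompletion L)) | IsSelfDualLattice (galAdicCompletionMap (L := L) (IsCMField.complexConj L) hw) ϖ (!![(0 : (w.1.adicCompletion L)), 1; 1, 0] : Matrix (Fin 2) (Fin 2) (w.1.adicCompletion L)) B ∧ mapGL (Matrix.GeneralLinearGroup.scalar (Fin 2) s * ((localNonsplitEquiv (IsCMField.complexConj L) (Matrix.of fun i j : Fin 2 => if i.val + j.val + 1 = 2 then (1 : L) else 0) (IsCMField.complexConj_ne_one L) w hw γH.1).val : GL (Fin 2) (w.1.adicCompletion L))) B = B ∧ (B.map ((Matrix.toLin' ((((Matrix.GeneralLinearGroup.scalar (Fin 2) s * ((localNonsplitEquiv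 (IsCMField.complexConj L) (Matrix.of fun i j : Fin 2 => if i.val + j.val + 1 = 2 then (1 : L) else 0) (IsCMField.complexConj_ne_one L) w hw γH.1).val : GL (Fin 2) (w.1.adicCompletion L))) : GL (Fin 2) (w.1.adicCompletion L)) : Matrix (Fin 2) (Fin 2) (w.1.adicCompletion L)) - ((((Matrix.GeneralLinearGroup.scalar (Fin 2) s * ((localNonsplitEquiv (IsCMField.complexConj L) (Matrix.of fun i j : Fin 2 => if i.val + j.val + 1 = 2 then (1 : L) else 0) (IsCMField.complexConj_ne_one L) w hw γH.1).val : GL (Fin 2) (w.1.adicCompletion L))) : GL (Fin 2) (w.1.adicCompletion L)) : Matrix (Fin 2) (Fin 2) (w.1.adicCompletion L)).trace / 2) • (1 : Matrix (Fin 2) (Fin 2) (w.1.adicCompletion L)))).restrictScalars (Valued.integer (w.1.adicCompletion L))) ≤ scaleLattice (ϖ ^ m) B ∧ ¬ B.map ((Matrix.toLin' ((((Matrix.GeneralLinearGroup.scalar (Fin 2) s * ((localNonsplitEquiv (IsCMField.complexConj L) (Matrix.of fun i j : Fin 2 => if i.val + j.val + 1 = 2 then (1 : L) else 0) (IsCMField.complexConj_ne_one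 L) w hw γH.1).val : GL (Fin 2) (w.1.adicCompletion L))) : GL (Fin 2) (w.1.adicCompletion L)) : Matrix (Fin 2) (Fin 2) (w.1.adicCompletion L)) - ((((Matrix.GeneralLinearGroup.scalar (Fin 2) s * ((localNonsplitEquiv (IsCMField.complexConj L) (Matrix.of fun i j : Fin 2 => if i.val + j.val + 1 = 2 then (1 : L) else 0) (IsCMField.complexConj_ne_one L) w hw γH.1).val : GL (Fin 2) (w.1.adicCompletion L))) : GL (Fin 2) (w.1.adicCompletion L)) : Matrix (Fin 2) (Fin 2) (w.1.adicCompletion L)).trace / 2) • (1 : Matrix (Fin 2) (Fin 2) (w.1.adicCompletion L)))).restrictScalars (Valued.integer (w.1.adicCompletion L))) ≤ scaleLattice (ϖ ^ (m + 1)) B ∧ ∃ y₂ ∈ B, ∃ a : (w.1.adicCompletion L), Valued.v a = 1 ∧ Valued.v ((ϖ ^ m)⁻¹ * pairing (galAdicCompletionMap (L := L) (IsCMField.complexConj L) hw) (!![(0 : (w.1.adicCompletion L)), 1; 1, 0] : Matrix (Fin 2) (Fin 2) (w.1.adicCompletion L)) y₂ (((((Matrix.GeneralLinearGroup.scalar (Fin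 2) s * ((localNonsplitEquiv (IsCMField.complexConj L) (Matrix.of fun i j : Fin 2 => if i.val + j.val + 1 = 2 then (1 : L) else 0) (IsCMField.complexConj_ne_one L) w hw γH.1).val : GL (Fin 2) (w.1.adicCompletion L))) : GL (Fin 2) (w.1.adicCompletion L)) : Matrix (Fin 2) (Fin 2) (w.1.adicCompletion L)) - ((((Matrix.GeneralLinearGroup.scalar (Fin 2) s * ((localNonsplitEquiv (IsCMField.complexConj L) (Matrix.of fun i j : Fin 2 => if i.val + j.val + 1 = 2 then (1 : L) else 0) (IsCMField.complexConj_ne_one L) w hw γH.1).val : GL (Fin 2) (w.1.adicCompletion L))) : GL (Fin 2) (w.1.adicCompletion L)) : Matrix (Fin 2) (Fin 2) (w.1.adicCompletion L)).trace / 2) • (1 : Matrix (Fin 2) (Fin 2) (w.1.adicCompletion L))) *ᵥ y₂) - ((ϖ ^ m)⁻¹ * ((((k⁻¹ * (Matrix.GeneralLinearGroup.scalar (Fin 2) s * ((localNonsplitEquiv (IsCMField.complexConj L) (Matrix.of fun i j : Fin 2 => if i.val + j.val + 1 = 2 then (1 : L) else 0) (IsCMField.complexConj_ne_one L) w hw γH.1).val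 : GL (Fin 2) (w.1.adicCompletion L))) * k) : GL (Fin 2) (w.1.adicCompletion L)) : Matrix (Fin 2) (Fin 2) (w.1.adicCompletion L)).trace / 2 - 1)) * a ^ 2) < 1)} =
      {B : Submodule (Valued.integer (w.1.adicCompletion L)) (Fin 2 → (w.1.adicCompletion L)) | IsSelfDualLattice (galAdicCompletionMap (L := L) (IsCMField.complexConj L) hw) ϖ (!![(0 : (w.1.adicCompletion L)), 1; 1, 0] : Matrix (Fin 2) (Fin 2) (w.1.adicCompletion L)) B ∧ mapGL (Matrix.GeneralLinearGroup.scalar (Fin 2) s * ((localNonsplitEquiv (IsCMField.complexConj L) (Matrix.of fun i j : Fin 2 => if i.val + j.val + 1 = 2 then (1 : L) else 0) (IsCMField.complexConj_ne_one L) w hw γH.1).val : GL (Fin 2) (w.1.adicCompletion L))) B = B ∧ ((B.map ((Matrix.toLin' ((((Matrix.GeneralLinearGroup.scalar (Fin 2) s * ((localNonsplitEquiv (IsCMField.complexConj L) (Matrix.of fun i j : Fin 2 => if i.val + j.val + 1 = 2 then (1 : L) else 0) (IsCMField.complexConj_ne_one L) w hw γH.1).val : GL (Fin 2) (w.1.adicCompletion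 L))) : GL (Fin 2) (w.1.adicCompletion L)) : Matrix (Fin 2) (Fin 2) (w.1.adicCompletion L)) - ((((Matrix.GeneralLinearGroup.scalar (Fin 2) s * ((localNonsplitEquiv (IsCMField.complexConj L) (Matrix.of fun i j : Fin 2 => if i.val + j.val + 1 = 2 then (1 : L) else 0) (IsCMField.complexConj_ne_one L) w hw γH.1).val : GL (Fin 2) (w.1.adicCompletion L))) : GL (Fin 2) (w.1.adicCompletion L)) : Matrix (Fin 2) (Fin 2) (w.1.adicCompletion L)).trace / 2) • (1 : Matrix (Fin 2) (Fin 2) (w.1.adicCompletion L)))).restrictScalars (Valued.integer (w.1.adicCompletion L))) ≤ scaleLattice (ϖ ^ (2 * (k' + 1))) B ∧ ¬ B.map ((Matrix.toLin' ((((Matrix.GeneralLinearGroup.scalar (Fin 2) s * ((localNonsplitEquiv (IsCMField.complexConj L) (Matrix.of fun i j : Fin 2 => if i.val + j.val + 1 = 2 then (1 : L) else 0) (IsCMField.complexConj_ne_one L) w hw γH.1).val : GL (Fin 2) (w.1.adicCompletion L))) : GL (Fin 2) (w.1.adicCompletion L)) : Matrix (Fin 2) (Fin 2) (w.1.adicCompletion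 L)) - ((((Matrix.GeneralLinearGroup.scalar (Fin 2) s * ((localNonsplitEquiv (IsCMField.complexConj L) (Matrix.of fun i j : Fin 2 => if i.val + j.val + 1 = 2 then (1 : L) else 0) (IsCMField.complexConj_ne_one L) w hw γH.1).val : GL (Fin 2) (w.1.adicCompletion L))) : GL (Fin 2) (w.1.adicCompletion L)) : Matrix (Fin 2) (Fin 2) (w.1.adicCompletion L)).trace / 2) • (1 : Matrix (Fin 2) (Fin 2) (w.1.adicCompletion L)))).restrictScalars (Valued.integer (w.1.adicCompletion L))) ≤ scaleLattice (ϖ ^ (m + 1)) B) ∧ ∃ y₂ ∈ B, ∃ a : (w.1.adicCompletion L), Valued.v a = 1 ∧ Valued.v ((ϖ ^ m)⁻¹ * pairing (galAdicCompletionMap (L := L) (IsCMField.complexConj L) hw) (!![(0 : (w.1.adicCompletion L)), 1; 1, 0] : Matrix (Fin 2) (Fin 2) (w.1.adicCompletion L)) y₂ (((((Matrix.GeneralLinearGroup.scalar (Fin 2) s * ((localNonsplitEquiv (IsCMField.complexConj L) (Matrix.of fun i j : Fin 2 => if i.val + j.val + 1 = 2 then (1 : L) else 0) (IsCMField.complexConj_ne_one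 L) w hw γH.1).val : GL (Fin 2) (w.1.adicCompletion L))) : GL (Fin 2) (w.1.adicCompletion L)) : Matrix (Fin 2) (Fin 2) (w.1.adicCompletion L)) - ((((Matrix.GeneralLinearGroup.scalar (Fin 2) s * ((localNonsplitEquiv (IsCMField.complexConj L) (Matrix.of fun i j : Fin 2 => if i.val + j.val + 1 = 2 then (1 : L) else 0) (IsCMField.complexConj_ne_one L) w hw γH.1).val : GL (Fin 2) (w.1.adicCompletion L))) : GL (Fin 2) (w.1.adicCompletion L)) : Matrix (Fin 2) (Fin 2) (w.1.adicCompletion L)).trace / 2) • (1 : Matrix (Fin 2) (Fin 2) (w.1.adicCompletion L))) *ᵥ y₂) - ((ϖ ^ m)⁻¹ * ((((k⁻¹ * (Matrix.GeneralLinearGroup.scalar (Fin 2) s * ((localNonsplitEquiv (IsCMField.complexConj L) (Matrix.of fun i j : Fin 2 => if i.val + j.val + 1 = 2 then (1 : L) else 0) (IsCMField.complexConj_ne_one L) w hw γH.1).val : GL (Fin 2) (w.1.adicCompletion L))) * k) : GL (Fin 2) (w.1.adicCompletion L)) : Matrix (Fin 2) (Fin 2) (w.1.adicCompletion L)).trace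 / 2 - 1)) * a ^ 2) < 1)} := by
    ext B
    simp only [Set.mem_setOf_eq]
    constructor
    · rintro ⟨hSD, hfix, hl, hn, hc⟩; exact ⟨hSD, hfix, ⟨((Set.ext_iff.1 e2 B).1 ⟨hSD, hfix, hl⟩).2.2, hn⟩, hc⟩
    · rintro ⟨hSD, hfix, ⟨hl, hn⟩, hc⟩; exact ⟨hSD, hfix, ((Set.ext_iff.1 e2 B).2 ⟨hSD, hfix, hl⟩).2.2, hn, hc⟩
  rw [hswap2]
  -- (5) pull `s·ĝ_w` back through the one-place model and read p05's centred-shell halves there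
  set γ₂' := (localNonsplitEquiv (IsCMField.complexConj L) (Matrix.of fun i j : Fin 2 => if i.val + j.val + 1 = 2 then (1 : L) else 0) (IsCMField.complexConj_ne_one L) w hw).symm ⟨(Matrix.GeneralLinearGroup.scalar (Fin 2) s * ((localNonsplitEquiv (IsCMField.complexConj L) (Matrix.of fun i j : Fin 2 => if i.val + j.val + 1 = 2 then (1 : L) else 0) (IsCMField.complexConj_ne_one L) w hw γH.1).val : GL (Fin 2) (w.1.adicCompletion L))), hGU⟩ with hγ₂'def
  have hGv : (((localNonsplitEquiv (IsCMField.complexConj L) (Matrix.of fun i j : Fin 2 => if i.val + j.val + 1 = 2 then (1 : L) else 0) (IsCMField.complexConj_ne_one L) w hw) γ₂' : ↥(unitaryGroupOfForm (galAdicCompletionMap (L := L) (IsCMField.complexConj L) hw) (placeForm (Matrix.of fun i j : Fin 2 => if i.val + j.val + 1 = 2 then (1 : L) else 0) w.1))) : GL (Fin 2) (w.1.adicCompletion L)) = (Matrix.GeneralLinearGroup.scalar (Fin 2) s * ((localNonsplitEquiv (IsCMField.complexConj L) (Matrix.of fun i j : Fin 2 => if i.val + j.val + 1 = 2 then (1 :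 L) else 0) (IsCMField.complexConj_ne_one L) w hw γH.1).val : GL (Fin 2) (w.1.adicCompletion L))) := by
    rw [hγ₂'def, ContinuousMulEquiv.apply_symm_apply]
  have hirr' : ¬ ∃ x : (w.1.adicCompletion L), ((((((localNonsplitEquiv (IsCMField.complexConj L) (Matrix.of fun i j : Fin 2 => if i.val + j.val + 1 = 2 then (1 : L) else 0) (IsCMField.complexConj_ne_one L) w hw) γ₂' : ↥(unitaryGroupOfForm (galAdicCompletionMap (L := L) (IsCMField.complexConj L) hw) (placeForm (Matrix.of fun i j : Fin 2 => if i.val + j.val + 1 = 2 then (1 : L) else 0) w.1))) : GL (Fin 2) (w.1.adicCompletion L)) : Matrix (Fin 2) (Fin 2) (w.1.adicCompletion L))).charpoly).IsRoot x := by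
    rw [hGv, coe_scalar_mul_eq_smul]
    rintro ⟨x, hx⟩
    exact forall_not_isRoot_charpoly_smul (Units.ne_zero s) hirrG x hx
  have hN' : Valued.v ((((((localNonsplitEquiv (IsCMField.complexConj L) (Matrix.of fun i j : Fin 2 => if i.val + j.val + 1 = 2 then (1 : L) else 0) (IsCMField.complexConj_ne_one L) w hw) γ₂' : ↥(unitaryGroupOfForm (galAdicCompletionMap (L := L) (IsCMField.complexConj L) hw) (placeForm (Matrix.of fun i j : Fin 2 => if i.val + j.val + 1 = 2 then (1 : L) else 0) w.1))) : GL (Fin 2) (w.1.adicCompletion L)) : Matrix (Fin 2) (Fin 2) (w.1.adicCompletion L))).trace ^ 2 - 4 * (((((localNonsplitEquiv (IsCMField.complexConj L) (Matrix.of fun i j : Fin 2 => if i.val + j.val + 1 = 2 then (1 : L) else 0) (IsCMField.complexConj_ne_one L) w hw) γ₂' : ↥(unitaryGroupOfForm (galAdicCompletionMap (L := L) (IsCMField.complexConj L) hw) (placeForm (Matrix.of fun i j : Fin 2 => if i.val + j.val + 1 = 2 then (1 : L) else 0) w.1))) : GL (Fin 2) (w.1.adicCompletion L)) : Matrix (Fin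 2) (Fin 2) (w.1.adicCompletion L))).det) = WithZero.exp (-((2 * (2 * n + 1) : ℕ) : ℤ)) := by
    rw [hGv]; exact hGN
  have hcD' : Valued.v ((((((localNonsplitEquiv (IsCMField.complexConj L) (Matrix.of fun i j : Fin 2 => if i.val + j.val + 1 = 2 then (1 : L) else 0) (IsCMField.complexConj_ne_one L) w hw) γ₂' : ↥(unitaryGroupOfForm (galAdicCompletionMap (L := L) (IsCMField.complexConj L) hw) (placeForm (Matrix.of fun i j : Fin 2 => if i.val + j.val + 1 = 2 then (1 : L) else 0) w.1))) : GL (Fin 2) (w.1.adicCompletion L)) : Matrix (Fin 2) (Fin 2) (w.1.adicCompletion L))).trace / 2 - 1) ≤ Valued.v (((Units.mk0 ϖ hϖ0 : (w.1.adicCompletion L)ˣ) : (w.1.adicCompletion L)) ^ (2 * (k' + 1) + 1)) := by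
    rw [hGv, coe_scalar_mul_eq_smul, Matrix.trace_smul, smul_eq_mul, mul_div_assoc, v_mul_trace_div_two_sub_one_eq h2w hs hsv, Units.val_mk0,
      show 2 * (k' + 1) + 1 = m by omega]
    exact hscG.le
  have ht0 : Valued.v ((ϖ ^ m)⁻¹ * ((((k⁻¹ * (Matrix.GeneralLinearGroup.scalar (Fin 2) s * ((localNonsplitEquiv (IsCMField.complexConj L) (Matrix.of fun i j : Fin 2 => if i.val + j.val + 1 = 2 then (1 : L) else 0) (IsCMField.complexConj_ne_one L) w hw γH.1).val : GL (Fin 2) (w.1.adicCompletion L))) * k) : GL (Fin 2) (w.1.adicCompletion L)) : Matrix (Fin 2) (Fin 2) (w.1.adicCompletion L)).trace / 2 - 1)) = 1 := by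
    rw [map_mul, map_inv₀, trace_coe_inv_conj_scalar_mul, mul_div_assoc, v_mul_trace_div_two_sub_one_eq h2w hs hsv, hscG,
      inv_mul_cancel₀ ((Valuation.ne_zero_iff _).2 (pow_ne_zero m hϖ0))]
  have c := UnitaryGroup.ncard_selfDual_fixed_centredShell_class_eq_pow_of_odd_depth_ramified L v w hw he h2 (Units.mk0 ϖ hϖ0) hϖ hσϖ γ₂' hirr' hN'
    (j := k' + 1) (by omega) hcD' _ ε ht0 hεv hε
  rw [hGv] at c
  simp only [Units.val_mk0] at c
  rw [show 2 * (k' + 1 + 1) = m + 1 by omega, show 2 * (k' + 1) + 1 = m by omega] at c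
  rw [← stdForm_antidiagonal_two_over_eq, ← placeForm_antidiagOne, c, show n - (k' + 1) = a by omega]

set_option maxHeartbeats 1600000 in
-- budget only: statement-heavy CM lattice tokens.
/-- **THE SHELL KIND COUNT OF THE HYPERBOLIC ROOT REGION, SMALL (centred class of `t₀` absent), `N = 2 * n + 1`, REGIME B** (`m = 2k′ + 3 < N`, `n = a + k′ + 1`): `n = q^a` (the outermost shell of the `W`-ball at odd `N`, halved by the centred class).
FILE 1 ∘ ★ A-p12 `selfDual_fixed_lev_eq_ball_of_le` (plain → centred on `B₀`) ∘ §1 transport `B ↦ k·B` to `s·ĝ_w` ∘ ★ A-p12 `selfDual_fixed_ball_odd_scale_eq` ∘ ★ p05 `ncard_selfDual_fixed_centredShell_class_eq_pow_of_odd_depth_ramified` after ★ p05 `setOf_selfDual_fixed_centredShell_not_class_eq_class_mul_…` (`¬CLS^c(t₀) = CLS^c(t₀ε)`), read at the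
pulled-back element `γ₂′ = (localNonsplitEquiv …).symm ⟨s·ĝ_w, _⟩`. [cite: Kottwitz1986, §3] [cite: Rogawski1990, §4.9 Lemma 4.9.3] [cite: LabesseLanglands1979, §2 Lemma 2.1 p. 8] [cite: BruhatTits1972, §10] -/
theorem ncard_rootRegion_shellSmall_hyperbolic_of_odd_B_ram (he : v.asIdeal.ramificationIdx' w.1.asIdeal ≠ 1)
    (h2 : IsUnit (2 : (ValuativeRel.valuation (w.1.adicCompletion L)).integer))
    (ϖ : w.1.adicCompletion L) (hϖ : Valued.v ϖ = WithZero.exp (-1 : ℤ)) (hσϖ : galAdicCompletionMap (L := L) (IsCMField.complexConj L) hw ϖ = -ϖ)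
    (γH : (cmDatum L 2 (Matrix.of fun i j : Fin 2 => if i.val + j.val + 1 = 2 then (1 : L) else 0)).Local v × (cmDatum L 1 (Matrix.of fun i j : Fin 1 => if i.val + j.val + 1 = 1 then (1 : L) else 0)).Local v)
    (hblk : ∀ i j : Fin 2, Valued.v (((((γH.1.val : GL (Fin 2) (UnitaryGroup.LocalRing L v)).val.map (Pi.evalRingHom (fun w' : PlacesOver L v => w'.1.adicCompletion L) w))) - 1) i j) ≤ Valued.v (ϖ ^ 2))
    (hu2 : Valued.v (finGammaTwo L v γH w - 1) ≤ Valued.v (ϖ ^ 2))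
    (hirr : ¬ ∃ x : (w.1.adicCompletion L), (((((γH.1.val : GL (Fin 2) (UnitaryGroup.LocalRing L v)).val.map (Pi.evalRingHom (fun w' : PlacesOver L v => w'.1.adicCompletion L) w)))).charpoly).IsRoot x)
    {n : ℕ}
    (hdisc : Valued.v (((((γH.1.val : GL (Fin 2) (UnitaryGroup.LocalRing L v)).val.map (Pi.evalRingHom (fun w' : PlacesOver L v => w'.1.adicCompletion L) w)))).trace ^ 2 - 4 * ((((γH.1.val : GL (Fin 2) (UnitaryGroup.LocalRing L v)).val.map (Pi.evalRingHom (fun w' : PlacesOver L v => w'.1.adicCompletion L) w)))).det) = WithZero.exp (-((2 * (2 * n + 1) : ℕ) : ℤ)))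
    (m : ℕ) (hm : Valued.v (((finCharpolyTwo L v γH).eval (finGammaTwo L v γH)) w) =
      Valued.v ((toPlace v w (HeckeCharacter.uniformizer ↥(maximalRealSubfield L) v : v.adicCompletion ↥(maximalRealSubfield L))) ^ m))
    (β : (v.adicCompletion ↥(maximalRealSubfield L))ˣ)
    (hβ : toPlace v w (β : v.adicCompletion ↥(maximalRealSubfield L)) =
      -(((finCharpolyTwo L v γH).eval (finGammaTwo L v γH)) w *
          (finGammaTwo L v γH w ^ 2 + ((γH.1.val.val : Matrix (Fin 2) (Fin 2) (LocalRing L v)).map (Pi.evalRingHom (fun w' : PlacesOver L v => w'.1.adicCompletion L) w)).det)) /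
        (2 * finGammaTwo L v γH w ^ 2 * ((γH.1.val.val : Matrix (Fin 2) (Fin 2) (LocalRing L v)).map (Pi.evalRingHom (fun w' : PlacesOver L v => w'.1.adicCompletion L) w)).det))
    (s : (w.1.adicCompletion L)ˣ)
    (hs : (s : w.1.adicCompletion L) * (((localNonsplitEquiv (IsCMField.complexConj L) (Matrix.of fun i j : Fin 1 => if i.val + j.val + 1 = 1 then (1 : L) else 0) (IsCMField.complexConj_ne_one L) w hw γH.2).val : GL (Fin 1) (w.1.adicCompletion L)) : Matrix (Fin 1) (Fin 1) (w.1.adicCompletion L)) 0 0 = 1)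
    (k : GL (Fin 2) (w.1.adicCompletion L))
    (hk : k ∈ unitaryGroupOfForm (galAdicCompletionMap (L := L) (IsCMField.complexConj L) hw) (placeForm (Matrix.of fun i j : Fin 2 => if i.val + j.val + 1 = 2 then (1 : L) else 0) w.1))
    (γ : unitaryGroupOfForm (galAdicCompletionMap (L := L) (IsCMField.complexConj L) hw) ((StdForm.antidiagonal 3).over (w.1.adicCompletion L)))
    (hγ : (γ : GL (Fin 3) (w.1.adicCompletion L)) = endoGL ((k⁻¹ * (Matrix.GeneralLinearGroup.scalar (Fin 2) s * ((localNonsplitEquiv (IsCMField.complexConj L) (Matrix.of fun i j : Fin 2 => if i.val + j.val + 1 = 2 then (1 : L) else 0) (IsCMField.complexConj_ne_one L) w hw γH.1).val : GL (Fin 2) (w.1.adicCompletion L))) * k), (1 : GL (Fin 1) (w.1.adicCompletion L))))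
    (k' a : ℕ) (hmk : m = 2 * k' + 3) (hna : n = a + k' + 1) (hlt : m < 2 * n + 1)
    (ε : (w.1.adicCompletion L)) (hεv : Valued.v ε = 1) (hε : ∀ z : (w.1.adicCompletion L), Valued.v z ≤ 1 → Valued.v (z ^ 2 - ε) = 1) :
    {x : {M : Submodule (Valued.integer (w.1.adicCompletion L)) (Fin 3 → (w.1.adicCompletion L)) // IsVertex (galAdicCompletionMap (L := L) (IsCMField.complexConj L) hw) ϖ ((StdForm.antidiagonal 3).over (w.1.adicCompletion L)) M} | x ∈ {x : {M : Submodule (Valued.integer (w.1.adicCompletion L)) (Fin 3 → (w.1.adicCompletion L)) // IsVertex (galAdicCompletionMap (L := L) (IsCMField.complexConj L) hw) ϖ ((StdForm.antidiagonal 3).over (w.1.adicCompletion L)) M} | latticeGraphIso (galAdicCompletionMap (L := L) (IsCMField.complexConj L) hw) ϖ ((StdForm.antidiagonal 3).over (w.1.adicCompletion L)) γ x = x ∧ IsSelfDualLattice (galAdicCompletionMap (L := L) (IsCMField.complexConj L) hw) ϖ ((StdForm.antidiagonal 3).over (w.1.adicCompletion L)) x.1 ∧ x.1.map ((Matrix.toLin'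 (((γ : GL (Fin 3) (w.1.adicCompletion L)) : Matrix (Fin 3) (Fin 3) (w.1.adicCompletion L)) - 1)).restrictScalars (Valued.integer (w.1.adicCompletion L))) ≤ scaleLattice (ϖ ^ m) x.1} ∧ ¬ (∀ y ∈ x.1, y 1 = 0 → ((((γ : GL (Fin 3) (w.1.adicCompletion L)) : Matrix (Fin 3) (Fin 3) (w.1.adicCompletion L)) - ((((k⁻¹ * (Matrix.GeneralLinearGroup.scalar (Fin 2) s * ((localNonsplitEquiv (IsCMField.complexConj L) (Matrix.of fun i j : Fin 2 => if i.val + j.val + 1 = 2 then (1 : L) else 0) (IsCMField.complexConj_ne_one L) w hw γH.1).val : GL (Fin 2) (w.1.adicCompletion L))) * k) : GL (Fin 2) (w.1.adicCompletion L)) : Matrix (Fin 2) (Fin 2) (w.1.adicCompletion L)).trace / 2) • (1 : Matrix (Fin 3) (Fin 3) (w.1.adicCompletion L))) *ᵥ y) ∈ scaleLattice (ϖ ^ (m + 1)) x.1) ∧ ¬ (∃ y ∈ x.1, y 1 = 0 ∧ ∃ a : (w.1.adicCompletion L), Valued.v a = 1 ∧ Valued.v ((ϖ ^ m)⁻¹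 * pairing (galAdicCompletionMap (L := L) (IsCMField.complexConj L) hw) ((StdForm.antidiagonal 3).over (w.1.adicCompletion L)) y ((((γ : GL (Fin 3) (w.1.adicCompletion L)) : Matrix (Fin 3) (Fin 3) (w.1.adicCompletion L)) - ((((k⁻¹ * (Matrix.GeneralLinearGroup.scalar (Fin 2) s * ((localNonsplitEquiv (IsCMField.complexConj L) (Matrix.of fun i j : Fin 2 => if i.val + j.val + 1 = 2 then (1 : L) else 0) (IsCMField.complexConj_ne_one L) w hw γH.1).val : GL (Fin 2) (w.1.adicCompletion L))) * k) : GL (Fin 2) (w.1.adicCompletion L)) : Matrix (Fin 2) (Fin 2) (w.1.adicCompletion L)).trace / 2) • (1 : Matrix (Fin 3) (Fin 3) (w.1.adicCompletion L))) *ᵥ y) - ((ϖ ^ m)⁻¹ * ((((k⁻¹ * (Matrix.GeneralLinearGroup.scalar (Fin 2) s * ((localNonsplitEquiv (IsCMField.complexConj L) (Matrix.of fun i j : Fin 2 => if i.val + j.val + 1 = 2 then (1 : L) else 0) (IsCMField.complexConj_ne_one L) w hw γH.1).val : GL (Fin 2) (w.1.adicCompletion L))) * k) : GL (Fin 2) (w.1.adicCompletion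 L)) : Matrix (Fin 2) (Fin 2) (w.1.adicCompletion L)).trace / 2 - 1)) * a ^ 2) < 1)}.ncard = Nat.card (𝓞 ↥(maximalRealSubfield L) ⧸ v.asIdeal) ^ a := by
  haveI := isPrincipalIdealRing_integer_adicCompletion L v w
  have hϖ0 : ϖ ≠ 0 := fun h0 => by rw [h0, map_zero] at hϖ; exact WithZero.coe_ne_zero hϖ.symm
  have hϖlt : Valued.v ϖ < 1 := by rw [hϖ, ← WithZero.exp_zero]; exact WithZero.exp_lt_exp.2 (by norm_num)
  have hϖ1 : Valued.v ϖ ≤ 1 := hϖlt.le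
  have hvϖ0 : 0 < Valued.v ϖ := by rw [hϖ]; exact WithZero.exp_pos
  have h2w : Valued.v (2 : (w.1.adicCompletion L)) = 1 := (isUnit_two_integer_iff_valued_eq_one L w.1).1 h2
  have hσσ : ∀ z : (w.1.adicCompletion L), (galAdicCompletionMap (L := L) (IsCMField.complexConj L) hw) ((galAdicCompletionMap (L := L) (IsCMField.complexConj L) hw) z) = z :=
    galAdicCompletionMap_galAdicCompletionMap_of_smul_eq (IsCMField.complexConj L) w (IsCMField.complexConj_ne_one L) hw
  have hvσ : ∀ z : (w.1.adicCompletion L), Valued.v ((galAdicCompletionMap (L := L) (IsCMField.complexConj L) hw) z) = Valued.v z := fun z => valued_galAdicCompletionMap (L := L) (IsCMField.complexConj L) hw z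
  have hsv : Valued.v (s : (w.1.adicCompletion L)) = 1 := by
    have h := congrArg Valued.v hs
    rwa [map_mul, v_oneByOne_eq_one_of_local L w hw γH.2, mul_one, map_one] at h
  have hk' : k ∈ unitaryGroupOfForm (galAdicCompletionMap (L := L) (IsCMField.complexConj L) hw) (!![(0 : (w.1.adicCompletion L)), 1; 1, 0] : Matrix (Fin 2) (Fin 2) (w.1.adicCompletion L)) := by
    rw [← stdForm_antidiagonal_two_over_eq, ← placeForm_antidiagOne]; exact hk
  -- THM 1's value gap `|det(B₀ − 1)| = |ϖ|^(2m) > |ϖ|^(2m+1)` (★ A-p19 FILE 4)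
  have hdet : Valued.v ϖ ^ (2 * m + 1) < Valued.v ((((k⁻¹ * (Matrix.GeneralLinearGroup.scalar (Fin 2) s * ((localNonsplitEquiv (IsCMField.complexConj L) (Matrix.of fun i j : Fin 2 => if i.val + j.val + 1 = 2 then (1 : L) else 0) (IsCMField.complexConj_ne_one L) w hw γH.1).val : GL (Fin 2) (w.1.adicCompletion L))) * k) : GL (Fin 2) (w.1.adicCompletion L)) : Matrix (Fin 2) (Fin 2) (w.1.adicCompletion L)) - (1 : Matrix (Fin 2) (Fin 2) (w.1.adicCompletion L))).det := by
    rw [v_det_rerootedCentred_sub_one_eq_ram L w hw he ϖ hϖ γH m hm s hs k]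
    exact pow_lt_pow_right_of_lt_one₀ hvϖ0 hϖlt (by omega)
  -- the chair's dictionary, regime B: `|2û₀₀ − tr ĝ_w| = |ϖ^m|`
  obtain ⟨-, hB, -⟩ := typeTwo_depthDictionary_odd_ram L w hw he h2 ϖ hϖ hσϖ hblk hu2 hirr hdisc m hm β hβ
  have hsc := (hB hlt).2.2.2
  -- FILE 1: the shell kind on the `W`-block of `B₀`
  rw [ncard_rootRegion_shell_not_class_eq_ncard_two hσσ hvσ hϖ γ _ hγ hdet]
  -- the plain level-`m` token of `B₀` is its centred one (A-p12 §3 at `Γ := B₀`; `|½tr B₀ − 1| = |ϖ^m|`)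
  have hck : Valued.v ((((k⁻¹ * (Matrix.GeneralLinearGroup.scalar (Fin 2) s * ((localNonsplitEquiv (IsCMField.complexConj L) (Matrix.of fun i j : Fin 2 => if i.val + j.val + 1 = 2 then (1 : L) else 0) (IsCMField.complexConj_ne_one L) w hw γH.1).val : GL (Fin 2) (w.1.adicCompletion L))) * k) : GL (Fin 2) (w.1.adicCompletion L)) : Matrix (Fin 2) (Fin 2) (w.1.adicCompletion L)).trace / 2 - 1) ≤ Valued.v (((Units.mk0 ϖ hϖ0 : (w.1.adicCompletion L)ˣ) : (w.1.adicCompletion L)) ^ m) := by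
    rw [trace_coe_inv_conj_scalar_mul, mul_div_assoc, v_mul_trace_div_two_sub_one_eq h2w hs hsv, Units.val_mk0, coe_localNonsplitEquiv_apply]
    exact hsc.le
  have e := selfDual_fixed_lev_eq_ball_of_le L v w hw he h2 (Units.mk0 ϖ hϖ0) (ϖ' := ϖ) _ m hck
  simp only [Units.val_mk0] at e
  -- (2) the plain level-`m` token is the centred one
  have hswap : {B : Submodule (Valued.integer (w.1.adicCompletion L)) (Fin 2 → (w.1.adicCompletion L)) | IsSelfDualLattice (galAdicCompletionMap (L := L) (IsCMField.complexConj L) hw) ϖ (!![(0 : (w.1.adicCompletion L)), 1; 1, 0] : Matrix (Fin 2) (Fin 2) (w.1.adicCompletion L)) B ∧ mapGL (k⁻¹ * (Matrix.GeneralLinearGroup.scalar (Fin 2) s * ((localNonsplitEquiv (IsCMField.complexConj L) (Matrix.of fun i j : Fin 2 => if i.val + j.val + 1 = 2 then (1 : L) else 0) (IsCMField.complexConj_ne_one L) w hw γH.1).val : GL (Fin 2) (w.1.adicCompletion L))) * k) B = B ∧ (B.map ((Matrix.toLin' ((((k⁻¹ * (Matrix.GeneralLinearGroup.scalar (Fin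 2) s * ((localNonsplitEquiv (IsCMField.complexConj L) (Matrix.of fun i j : Fin 2 => if i.val + j.val + 1 = 2 then (1 : L) else 0) (IsCMField.complexConj_ne_one L) w hw γH.1).val : GL (Fin 2) (w.1.adicCompletion L))) * k) : GL (Fin 2) (w.1.adicCompletion L)) : Matrix (Fin 2) (Fin 2) (w.1.adicCompletion L)) - 1)).restrictScalars (Valued.integer (w.1.adicCompletion L))) ≤ scaleLattice (ϖ ^ m) B ∧ ¬ B.map ((Matrix.toLin' ((((k⁻¹ * (Matrix.GeneralLinearGroup.scalar (Fin 2) s * ((localNonsplitEquiv (IsCMField.complexConj L) (Matrix.of fun i j : Fin 2 => if i.val + j.val + 1 = 2 then (1 : L) else 0) (IsCMField.complexConj_ne_one L) w hw γH.1).val : GL (Fin 2) (w.1.adicCompletion L))) * k) : GL (Fin 2) (w.1.adicCompletion L)) : Matrix (Fin 2) (Fin 2) (w.1.adicCompletion L)) - ((((k⁻¹ * (Matrix.GeneralLinearGroup.scalar (Fin 2) s * ((localNonsplitEquiv (IsCMField.complexConj L) (Matrix.of fun i j : Fin 2 => if i.val + j.val + 1 = 2 then (1 : L) else 0) (IsCMField.complexConj_ne_one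 L) w hw γH.1).val : GL (Fin 2) (w.1.adicCompletion L))) * k) : GL (Fin 2) (w.1.adicCompletion L)) : Matrix (Fin 2) (Fin 2) (w.1.adicCompletion L)).trace / 2) • (1 : Matrix (Fin 2) (Fin 2) (w.1.adicCompletion L)))).restrictScalars (Valued.integer (w.1.adicCompletion L))) ≤ scaleLattice (ϖ ^ (m + 1)) B ∧ ¬ (∃ y₂ ∈ B, ∃ a : (w.1.adicCompletion L), Valued.v a = 1 ∧ Valued.v ((ϖ ^ m)⁻¹ * pairing (galAdicCompletionMap (L := L) (IsCMField.complexConj L) hw) (!![(0 : (w.1.adicCompletion L)), 1; 1, 0] : Matrix (Fin 2) (Fin 2) (w.1.adicCompletion L)) y₂ (((((k⁻¹ * (Matrix.GeneralLinearGroup.scalar (Fin 2) s * ((localNonsplitEquiv (IsCMField.complexConj L) (Matrix.of fun i j : Fin 2 => if i.val + j.val + 1 = 2 then (1 : L) else 0) (IsCMField.complexConj_ne_one L) w hw γH.1).val : GL (Fin 2) (w.1.adicCompletion L))) * k) : GL (Fin 2) (w.1.adicCompletion L)) : Matrix (Fin 2) (Fin 2) (w.1.adicCompletion L)) - ((((k⁻¹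 * (Matrix.GeneralLinearGroup.scalar (Fin 2) s * ((localNonsplitEquiv (IsCMField.complexConj L) (Matrix.of fun i j : Fin 2 => if i.val + j.val + 1 = 2 then (1 : L) else 0) (IsCMField.complexConj_ne_one L) w hw γH.1).val : GL (Fin 2) (w.1.adicCompletion L))) * k) : GL (Fin 2) (w.1.adicCompletion L)) : Matrix (Fin 2) (Fin 2) (w.1.adicCompletion L)).trace / 2) • (1 : Matrix (Fin 2) (Fin 2) (w.1.adicCompletion L))) *ᵥ y₂) - ((ϖ ^ m)⁻¹ * ((((k⁻¹ * (Matrix.GeneralLinearGroup.scalar (Fin 2) s * ((localNonsplitEquiv (IsCMField.complexConj L) (Matrix.of fun i j : Fin 2 => if i.val + j.val + 1 = 2 then (1 : L) else 0) (IsCMField.complexConj_ne_one L) w hw γH.1).val : GL (Fin 2) (w.1.adicCompletion L))) * k) : GL (Fin 2) (w.1.adicCompletion L)) : Matrix (Fin 2) (Fin 2) (w.1.adicCompletion L)).trace / 2 - 1)) * a ^ 2) < 1))} =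
      {B : Submodule (Valued.integer (w.1.adicCompletion L)) (Fin 2 → (w.1.adicCompletion L)) | IsSelfDualLattice (galAdicCompletionMap (L := L) (IsCMField.complexConj L) hw) ϖ (!![(0 : (w.1.adicCompletion L)), 1; 1, 0] : Matrix (Fin 2) (Fin 2) (w.1.adicCompletion L)) B ∧ mapGL (k⁻¹ * (Matrix.GeneralLinearGroup.scalar (Fin 2) s * ((localNonsplitEquiv (IsCMField.complexConj L) (Matrix.of fun i j : Fin 2 => if i.val + j.val + 1 = 2 then (1 : L) else 0) (IsCMField.complexConj_ne_one L) w hw γH.1).val : GL (Fin 2) (w.1.adicCompletion L))) * k) B = B ∧ (B.map ((Matrix.toLin' ((((k⁻¹ * (Matrix.GeneralLinearGroup.scalar (Fin 2) s * ((localNonsplitEquiv (IsCMField.complexConj L) (Matrix.of fun i j : Fin 2 => if i.val + j.val + 1 = 2 then (1 : L) else 0) (IsCMField.complexConj_ne_one L) w hw γH.1).val : GL (Fin 2) (w.1.adicCompletion L))) * k) : GL (Fin 2) (w.1.adicCompletion L)) : Matrix (Fin 2) (Fin 2) (w.1.adicCompletion L)) - ((((k⁻¹ * (Matrix.GeneralLinearGroup.scalar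 (Fin 2) s * ((localNonsplitEquiv (IsCMField.complexConj L) (Matrix.of fun i j : Fin 2 => if i.val + j.val + 1 = 2 then (1 : L) else 0) (IsCMField.complexConj_ne_one L) w hw γH.1).val : GL (Fin 2) (w.1.adicCompletion L))) * k) : GL (Fin 2) (w.1.adicCompletion L)) : Matrix (Fin 2) (Fin 2) (w.1.adicCompletion L)).trace / 2) • (1 : Matrix (Fin 2) (Fin 2) (w.1.adicCompletion L)))).restrictScalars (Valued.integer (w.1.adicCompletion L))) ≤ scaleLattice (ϖ ^ m) B ∧ ¬ B.map ((Matrix.toLin' ((((k⁻¹ * (Matrix.GeneralLinearGroup.scalar (Fin 2) s * ((localNonsplitEquiv (IsCMField.complexConj L) (Matrix.of fun i j : Fin 2 => if i.val + j.val + 1 = 2 then (1 : L) else 0) (IsCMField.complexConj_ne_one L) w hw γH.1).val : GL (Fin 2) (w.1.adicCompletion L))) * k) : GL (Fin 2) (w.1.adicCompletion L)) : Matrix (Fin 2) (Fin 2) (w.1.adicCompletion L)) - ((((k⁻¹ * (Matrix.GeneralLinearGroup.scalar (Fin 2) s * ((localNonsplitEquiv (IsCMField.complexConj L) (Matrix.of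 fun i j : Fin 2 => if i.val + j.val + 1 = 2 then (1 : L) else 0) (IsCMField.complexConj_ne_one L) w hw γH.1).val : GL (Fin 2) (w.1.adicCompletion L))) * k) : GL (Fin 2) (w.1.adicCompletion L)) : Matrix (Fin 2) (Fin 2) (w.1.adicCompletion L)).trace / 2) • (1 : Matrix (Fin 2) (Fin 2) (w.1.adicCompletion L)))).restrictScalars (Valued.integer (w.1.adicCompletion L))) ≤ scaleLattice (ϖ ^ (m + 1)) B ∧ ¬ (∃ y₂ ∈ B, ∃ a : (w.1.adicCompletion L), Valued.v a = 1 ∧ Valued.v ((ϖ ^ m)⁻¹ * pairing (galAdicCompletionMap (L := L) (IsCMField.complexConj L) hw) (!![(0 : (w.1.adicCompletion L)), 1; 1, 0] : Matrix (Fin 2) (Fin 2) (w.1.adicCompletion L)) y₂ (((((k⁻¹ * (Matrix.GeneralLinearGroup.scalar (Fin 2) s * ((localNonsplitEquiv (IsCMField.complexConj L) (Matrix.of fun i j : Fin 2 => if i.val + j.val + 1 = 2 then (1 : L) else 0) (IsCMField.complexConj_ne_one L) w hw γH.1).val : GL (Fin 2) (w.1.adicCompletion L))) * k) : GL (Fin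 2) (w.1.adicCompletion L)) : Matrix (Fin 2) (Fin 2) (w.1.adicCompletion L)) - ((((k⁻¹ * (Matrix.GeneralLinearGroup.scalar (Fin 2) s * ((localNonsplitEquiv (IsCMField.complexConj L) (Matrix.of fun i j : Fin 2 => if i.val + j.val + 1 = 2 then (1 : L) else 0) (IsCMField.complexConj_ne_one L) w hw γH.1).val : GL (Fin 2) (w.1.adicCompletion L))) * k) : GL (Fin 2) (w.1.adicCompletion L)) : Matrix (Fin 2) (Fin 2) (w.1.adicCompletion L)).trace / 2) • (1 : Matrix (Fin 2) (Fin 2) (w.1.adicCompletion L))) *ᵥ y₂) - ((ϖ ^ m)⁻¹ * ((((k⁻¹ * (Matrix.GeneralLinearGroup.scalar (Fin 2) s * ((localNonsplitEquiv (IsCMField.complexConj L) (Matrix.of fun i j : Fin 2 => if i.val + j.val + 1 = 2 then (1 : L) else 0) (IsCMField.complexConj_ne_one L) w hw γH.1).val : GL (Fin 2) (w.1.adicCompletion L))) * k) : GL (Fin 2) (w.1.adicCompletion L)) : Matrix (Fin 2) (Fin 2) (w.1.adicCompletion L)).trace / 2 - 1)) * a ^ 2) < 1))} := by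
    ext B
    simp only [Set.mem_setOf_eq]
    constructor
    · rintro ⟨hSD, hfix, hl, hrest⟩; exact ⟨hSD, hfix, ((Set.ext_iff.1 e B).1 ⟨hSD, hfix, hl⟩).2.2, hrest⟩
    · rintro ⟨hSD, hfix, hl, hrest⟩; exact ⟨hSD, hfix, ((Set.ext_iff.1 e B).2 ⟨hSD, hfix, hl⟩).2.2, hrest⟩
  rw [hswap]
  -- (3) transport `B ↦ k·B` to `s·ĝ_w` (`k` is an isometry: the class constant `t₀` is unchanged)
  have t := ncard_selfDual_fixed_centredShell_not_class_conj_eq (galAdicCompletionMap (L := L) (IsCMField.complexConj L) hw) ϖ (!![(0 : (w.1.adicCompletion L)), 1; 1, 0] : Matrix (Fin 2) (Fin 2) (w.1.adicCompletion L)) (Subgroup.inv_mem _ hk') (Matrix.GeneralLinearGroup.scalar (Fin 2) s * ((localNonsplitEquiv (IsCMField.complexConj L) (Matrix.of fun i j : Fin 2 => if i.val + j.val + 1 = 2 then (1 : L) else 0) (IsCMField.complexConj_ne_one L) w hw γH.1).val : GL (Fin 2) (w.1.adicCompletion L))) (ϖ ^ m) (ϖ ^ (m + 1)) ((ϖ ^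 m)⁻¹) ((ϖ ^ m)⁻¹ * ((((k⁻¹ * (Matrix.GeneralLinearGroup.scalar (Fin 2) s * ((localNonsplitEquiv (IsCMField.complexConj L) (Matrix.of fun i j : Fin 2 => if i.val + j.val + 1 = 2 then (1 : L) else 0) (IsCMField.complexConj_ne_one L) w hw γH.1).val : GL (Fin 2) (w.1.adicCompletion L))) * k) : GL (Fin 2) (w.1.adicCompletion L)) : Matrix (Fin 2) (Fin 2) (w.1.adicCompletion L)).trace / 2 - 1))
  simp only [inv_inv] at t
  rw [t]
  -- (4) `s·ĝ_w`: unitary, 2-deep, same discriminant depth, `|½tr(s·ĝ_w) − 1| = |ϖ^m|`; odd centred scale `ϖ^m` collapses to `ϖ^(2(k′+1))`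
  have hblk' : ∀ i j : Fin 2, Valued.v (((((localNonsplitEquiv (IsCMField.complexConj L) (Matrix.of fun i j : Fin 2 => if i.val + j.val + 1 = 2 then (1 : L) else 0) (IsCMField.complexConj_ne_one L) w hw γH.1).val : GL (Fin 2) (w.1.adicCompletion L)) : Matrix (Fin 2) (Fin 2) (w.1.adicCompletion L)) - 1) i j) ≤ Valued.v (ϖ ^ 2) := hblk
  have hirrG : ∀ x : (w.1.adicCompletion L), ¬ (((((localNonsplitEquiv (IsCMField.complexConj L) (Matrix.of fun i j : Fin 2 => if i.val + j.val + 1 = 2 then (1 : L) else 0) (IsCMField.complexConj_ne_one L) w hw γH.1).val : GL (Fin 2) (w.1.adicCompletion L)) : Matrix (Fin 2) (Fin 2) (w.1.adicCompletion L))).charpoly).IsRoot x := fun x hx => hirr ⟨x, hx⟩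
  have hdiscG : Valued.v (((((localNonsplitEquiv (IsCMField.complexConj L) (Matrix.of fun i j : Fin 2 => if i.val + j.val + 1 = 2 then (1 : L) else 0) (IsCMField.complexConj_ne_one L) w hw γH.1).val : GL (Fin 2) (w.1.adicCompletion L)) : Matrix (Fin 2) (Fin 2) (w.1.adicCompletion L))).trace ^ 2 - 4 * ((((localNonsplitEquiv (IsCMField.complexConj L) (Matrix.of fun i j : Fin 2 => if i.val + j.val + 1 = 2 then (1 : L) else 0) (IsCMField.complexConj_ne_one L) w hw γH.1).val : GL (Fin 2) (w.1.adicCompletion L)) : Matrix (Fin 2) (Fin 2) (w.1.adicCompletion L))).det) = WithZero.exp (-((2 * (2 * n + 1) : ℕ) : ℤ)) := hdisc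
  have hscG : Valued.v (2 * ((((localNonsplitEquiv (IsCMField.complexConj L) (Matrix.of fun i j : Fin 1 => if i.val + j.val + 1 = 1 then (1 : L) else 0) (IsCMField.complexConj_ne_one L) w hw γH.2).val : GL (Fin 1) (w.1.adicCompletion L))) : Matrix (Fin 1) (Fin 1) (w.1.adicCompletion L)) 0 0 - ((((localNonsplitEquiv (IsCMField.complexConj L) (Matrix.of fun i j : Fin 2 => if i.val + j.val + 1 = 2 then (1 : L) else 0) (IsCMField.complexConj_ne_one L) w hw γH.1).val : GL (Fin 2) (w.1.adicCompletion L)) : Matrix (Fin 2) (Fin 2) (w.1.adicCompletion L))).trace) = Valued.v (ϖ ^ m) := hsc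
  have hu00 : ((((localNonsplitEquiv (IsCMField.complexConj L) (Matrix.of fun i j : Fin 1 => if i.val + j.val + 1 = 1 then (1 : L) else 0) (IsCMField.complexConj_ne_one L) w hw γH.2).val : GL (Fin 1) (w.1.adicCompletion L))) : Matrix (Fin 1) (Fin 1) (w.1.adicCompletion L)) 0 0 = finGammaTwo L v γH w := rfl
  have huu : (galAdicCompletionMap (L := L) (IsCMField.complexConj L) hw) (finGammaTwo L v γH w) * finGammaTwo L v γH w = 1 := by
    have h := congrArg (fun y : LocalRing L v => y w) (conjLocal_finGammaTwo_mul_finGammaTwo L v γH)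
    simpa only [Pi.mul_apply, Pi.one_apply, conjLocal_apply_eq_galAdicCompletionMap L v w hw] using h
  have hs1 : (s : (w.1.adicCompletion L)) * finGammaTwo L v γH w = 1 := by rw [← hu00]; exact hs
  have hsnorm : (galAdicCompletionMap (L := L) (IsCMField.complexConj L) hw) (s : (w.1.adicCompletion L)) * (s : (w.1.adicCompletion L)) = 1 := norm_eq_one_of_mul_eq_one_of_norm_eq_one huu hs1
  have hGU : (Matrix.GeneralLinearGroup.scalar (Fin 2) s * ((localNonsplitEquiv (IsCMField.complexConj L) (Matrix.of fun i j : Fin 2 => if i.val + j.val + 1 = 2 then (1 : L) else 0) (IsCMField.complexConj_ne_one L) w hw γH.1).val : GL (Fin 2) (w.1.adicCompletion L))) ∈ unitaryGroupOfForm (galAdicCompletionMap (L := L) (IsCMField.complexConj L) hw) (placeForm (Matrix.of fun i j : Fin 2 => if i.val + j.val + 1 = 2 then (1 : L) else 0) w.1) := scalar_mul_mem_unitaryGroupOfForm (localNonsplitEquiv (IsCMField.complexConj L) (Matrix.of fun i j : Fin 2 => if i.val + j.val + 1 = 2 then (1 : L) else 0) (IsCMField.complexConj_ne_one L) w hw γH.1).2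 s hsnorm
  have hG2 : ∀ i j : Fin 2, Valued.v (((((Matrix.GeneralLinearGroup.scalar (Fin 2) s * ((localNonsplitEquiv (IsCMField.complexConj L) (Matrix.of fun i j : Fin 2 => if i.val + j.val + 1 = 2 then (1 : L) else 0) (IsCMField.complexConj_ne_one L) w hw γH.1).val : GL (Fin 2) (w.1.adicCompletion L))) : GL (Fin 2) (w.1.adicCompletion L)) : Matrix (Fin 2) (Fin 2) (w.1.adicCompletion L)) - 1) i j) ≤ Valued.v (ϖ ^ 2) := by
    intro i j
    have es : (s : (w.1.adicCompletion L)) • (((localNonsplitEquiv (IsCMField.complexConj L) (Matrix.of fun i j : Fin 2 => if i.val + j.val + 1 = 2 then (1 : L) else 0) (IsCMField.complexConj_ne_one L) w hw γH.1).val : GL (Fin 2) (w.1.adicCompletion L)) : Matrix (Fin 2) (Fin 2) (w.1.adicCompletion L)) - 1 = (s : (w.1.adicCompletion L)) • ((((localNonsplitEquiv (IsCMField.complexConj L) (Matrix.of fun i j : Fin 2 => if i.val + j.val + 1 = 2 then (1 : L) else 0) (IsCMField.complexConj_ne_one L) w hw γH.1).val : GL (Fin 2) (w.1.adicCompletion L))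 : Matrix (Fin 2) (Fin 2) (w.1.adicCompletion L)) - ((((localNonsplitEquiv (IsCMField.complexConj L) (Matrix.of fun i j : Fin 1 => if i.val + j.val + 1 = 1 then (1 : L) else 0) (IsCMField.complexConj_ne_one L) w hw γH.2).val : GL (Fin 1) (w.1.adicCompletion L))) : Matrix (Fin 1) (Fin 1) (w.1.adicCompletion L)) 0 0 • (1 : Matrix (Fin 2) (Fin 2) (w.1.adicCompletion L))) := by
      rw [smul_sub, smul_smul, hs, one_smul]
    rw [coe_scalar_mul_eq_smul, es, Matrix.smul_apply, smul_eq_mul, map_mul, hsv, one_mul]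
    have e1 : ((((localNonsplitEquiv (IsCMField.complexConj L) (Matrix.of fun i j : Fin 2 => if i.val + j.val + 1 = 2 then (1 : L) else 0) (IsCMField.complexConj_ne_one L) w hw γH.1).val : GL (Fin 2) (w.1.adicCompletion L)) : Matrix (Fin 2) (Fin 2) (w.1.adicCompletion L)) - ((((localNonsplitEquiv (IsCMField.complexConj L) (Matrix.of fun i j : Fin 1 => if i.val + j.val + 1 = 1 then (1 : L) else 0) (IsCMField.complexConj_ne_one L) w hw γH.2).val : GL (Fin 1) (w.1.adicCompletion L))) : Matrix (Fin 1) (Fin 1) (w.1.adicCompletion L)) 0 0 • (1 : Matrix (Fin 2) (Fin 2) (w.1.adicCompletion L))) i j = ((((localNonsplitEquiv (IsCMField.complexConj L) (Matrix.of fun i j : Fin 2 => if i.val + j.val + 1 = 2 then (1 : L) else 0) (IsCMField.complexConj_ne_one L) w hw γH.1).val : GL (Fin 2) (w.1.adicCompletion L)) : Matrix (Fin 2) (Fin 2) (w.1.adicCompletion L)) - 1) i j - (((((localNonsplitEquiv (IsCMField.complexConj L) (Matrix.of fun i j : Fin 1 => if i.val + j.val + 1 = 1 then (1 : L) else 0)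 (IsCMField.complexConj_ne_one L) w hw γH.2).val : GL (Fin 1) (w.1.adicCompletion L))) : Matrix (Fin 1) (Fin 1) (w.1.adicCompletion L)) 0 0 - 1) * (1 : Matrix (Fin 2) (Fin 2) (w.1.adicCompletion L)) i j := by
      simp only [Matrix.sub_apply, Matrix.smul_apply, smul_eq_mul]; ring
    rw [e1]
    refine le_trans (Valuation.map_sub _ _ _) (max_le (hblk' i j) ?_)
    rw [map_mul, hu00]
    by_cases hij : i = j
    · rw [hij, Matrix.one_apply_eq, map_one, mul_one]; exact hu2
    · rw [Matrix.one_apply_ne hij, map_zero, mul_zero]; exact zero_le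
  have hGN : Valued.v (((((Matrix.GeneralLinearGroup.scalar (Fin 2) s * ((localNonsplitEquiv (IsCMField.complexConj L) (Matrix.of fun i j : Fin 2 => if i.val + j.val + 1 = 2 then (1 : L) else 0) (IsCMField.complexConj_ne_one L) w hw γH.1).val : GL (Fin 2) (w.1.adicCompletion L))) : GL (Fin 2) (w.1.adicCompletion L)) : Matrix (Fin 2) (Fin 2) (w.1.adicCompletion L))).trace ^ 2 - 4 * ((((Matrix.GeneralLinearGroup.scalar (Fin 2) s * ((localNonsplitEquiv (IsCMField.complexConj L) (Matrix.of fun i j : Fin 2 => if i.val + j.val + 1 = 2 then (1 : L) else 0) (IsCMField.complexConj_ne_one L) w hw γH.1).val : GL (Fin 2) (w.1.adicCompletion L))) : GL (Fin 2) (w.1.adicCompletion L)) : Matrix (Fin 2) (Fin 2) (w.1.adicCompletion L))).det) = WithZero.exp (-((2 * (2 * n + 1) : ℕ) : ℤ)) := by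
    rw [coe_scalar_mul_eq_smul, v_trace_sq_sub_four_mul_det_smul hsv]; exact hdiscG
  have e2 := selfDual_fixed_ball_odd_scale_eq L v w hw he h2 (Units.mk0 ϖ hϖ0) hϖ hσϖ (ϖ' := ϖ) _ hGU hG2 (N := 2 * n + 1) hGN (j := k' + 1) (by omega)
  simp only [Units.val_mk0] at e2
  rw [show 2 * (k' + 1) + 1 = m by omega] at e2
  have hswap2 : {B : Submodule (Valued.integer (w.1.adicCompletion L)) (Fin 2 → (w.1.adicCompletion L)) | IsSelfDualLattice (galAdicCompletionMap (L := L) (IsCMField.complexConj L) hw) ϖ (!![(0 : (w.1.adicCompletion L)), 1; 1, 0] : Matrix (Fin 2) (Fin 2) (w.1.adicCompletion L)) B ∧ mapGL (Matrix.GeneralLinearGroup.scalar (Fin 2) s * ((localNonsplitEquiv (IsCMField.complexConj L) (Matrix.of fun i j : Fin 2 => if i.val + j.val + 1 = 2 then (1 : L) else 0) (IsCMField.complexConj_ne_one L) w hw γH.1).val : GL (Fin 2) (w.1.adicCompletion L))) B = B ∧ (B.map ((Matrix.toLin' ((((Matrix.GeneralLinearGroup.scalar (Fin 2) s * ((localNonsplitEquiv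 (IsCMField.complexConj L) (Matrix.of fun i j : Fin 2 => if i.val + j.val + 1 = 2 then (1 : L) else 0) (IsCMField.complexConj_ne_one L) w hw γH.1).val : GL (Fin 2) (w.1.adicCompletion L))) : GL (Fin 2) (w.1.adicCompletion L)) : Matrix (Fin 2) (Fin 2) (w.1.adicCompletion L)) - ((((Matrix.GeneralLinearGroup.scalar (Fin 2) s * ((localNonsplitEquiv (IsCMField.complexConj L) (Matrix.of fun i j : Fin 2 => if i.val + j.val + 1 = 2 then (1 : L) else 0) (IsCMField.complexConj_ne_one L) w hw γH.1).val : GL (Fin 2) (w.1.adicCompletion L))) : GL (Fin 2) (w.1.adicCompletion L)) : Matrix (Fin 2) (Fin 2) (w.1.adicCompletion L)).trace / 2) • (1 : Matrix (Fin 2) (Fin 2) (w.1.adicCompletion L)))).restrictScalars (Valued.integer (w.1.adicCompletion L))) ≤ scaleLattice (ϖ ^ m) B ∧ ¬ B.map ((Matrix.toLin' ((((Matrix.GeneralLinearGroup.scalar (Fin 2) s * ((localNonsplitEquiv (IsCMField.complexConj L) (Matrix.of fun i j : Fin 2 => if i.val + j.val + 1 = 2 then (1 : L) else 0) (IsCMField.complexConj_ne_one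 L) w hw γH.1).val : GL (Fin 2) (w.1.adicCompletion L))) : GL (Fin 2) (w.1.adicCompletion L)) : Matrix (Fin 2) (Fin 2) (w.1.adicCompletion L)) - ((((Matrix.GeneralLinearGroup.scalar (Fin 2) s * ((localNonsplitEquiv (IsCMField.complexConj L) (Matrix.of fun i j : Fin 2 => if i.val + j.val + 1 = 2 then (1 : L) else 0) (IsCMField.complexConj_ne_one L) w hw γH.1).val : GL (Fin 2) (w.1.adicCompletion L))) : GL (Fin 2) (w.1.adicCompletion L)) : Matrix (Fin 2) (Fin 2) (w.1.adicCompletion L)).trace / 2) • (1 : Matrix (Fin 2) (Fin 2) (w.1.adicCompletion L)))).restrictScalars (Valued.integer (w.1.adicCompletion L))) ≤ scaleLattice (ϖ ^ (m + 1)) B ∧ ¬ (∃ y₂ ∈ B, ∃ a : (w.1.adicCompletion L), Valued.v a = 1 ∧ Valued.v ((ϖ ^ m)⁻¹ * pairing (galAdicCompletionMap (L := L) (IsCMField.complexConj L) hw) (!![(0 : (w.1.adicCompletion L)), 1; 1, 0] : Matrix (Fin 2) (Fin 2) (w.1.adicCompletion L)) y₂ (((((Matrix.GeneralLinearGroup.scalar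 (Fin 2) s * ((localNonsplitEquiv (IsCMField.complexConj L) (Matrix.of fun i j : Fin 2 => if i.val + j.val + 1 = 2 then (1 : L) else 0) (IsCMField.complexConj_ne_one L) w hw γH.1).val : GL (Fin 2) (w.1.adicCompletion L))) : GL (Fin 2) (w.1.adicCompletion L)) : Matrix (Fin 2) (Fin 2) (w.1.adicCompletion L)) - ((((Matrix.GeneralLinearGroup.scalar (Fin 2) s * ((localNonsplitEquiv (IsCMField.complexConj L) (Matrix.of fun i j : Fin 2 => if i.val + j.val + 1 = 2 then (1 : L) else 0) (IsCMField.complexConj_ne_one L) w hw γH.1).val : GL (Fin 2) (w.1.adicCompletion L))) : GL (Fin 2) (w.1.adicCompletion L)) : Matrix (Fin 2) (Fin 2) (w.1.adicCompletion L)).trace / 2) • (1 : Matrix (Fin 2) (Fin 2) (w.1.adicCompletion L))) *ᵥ y₂) - ((ϖ ^ m)⁻¹ * ((((k⁻¹ * (Matrix.GeneralLinearGroup.scalar (Fin 2) s * ((localNonsplitEquiv (IsCMField.complexConj L) (Matrix.of fun i j : Fin 2 => if i.val + j.val + 1 = 2 then (1 : L) else 0) (IsCMField.complexConj_ne_one L)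 w hw γH.1).val : GL (Fin 2) (w.1.adicCompletion L))) * k) : GL (Fin 2) (w.1.adicCompletion L)) : Matrix (Fin 2) (Fin 2) (w.1.adicCompletion L)).trace / 2 - 1)) * a ^ 2) < 1))} =
      {B : Submodule (Valued.integer (w.1.adicCompletion L)) (Fin 2 → (w.1.adicCompletion L)) | IsSelfDualLattice (galAdicCompletionMap (L := L) (IsCMField.complexConj L) hw) ϖ (!![(0 : (w.1.adicCompletion L)), 1; 1, 0] : Matrix (Fin 2) (Fin 2) (w.1.adicCompletion L)) B ∧ mapGL (Matrix.GeneralLinearGroup.scalar (Fin 2) s * ((localNonsplitEquiv (IsCMField.complexConj L) (Matrix.of fun i j : Fin 2 => if i.val + j.val + 1 = 2 then (1 : L) else 0) (IsCMField.complexConj_ne_one L) w hw γH.1).val : GL (Fin 2) (w.1.adicCompletion L))) B = B ∧ ((B.map ((Matrix.toLin' ((((Matrix.GeneralLinearGroup.scalar (Fin 2) s * ((localNonsplitEquiv (IsCMField.complexConj L) (Matrix.of fun i j : Fin 2 => if i.val + j.val + 1 = 2 then (1 : L) else 0) (IsCMField.complexConj_ne_one L) w hw γH.1).val : GL (Fin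 2) (w.1.adicCompletion L))) : GL (Fin 2) (w.1.adicCompletion L)) : Matrix (Fin 2) (Fin 2) (w.1.adicCompletion L)) - ((((Matrix.GeneralLinearGroup.scalar (Fin 2) s * ((localNonsplitEquiv (IsCMField.complexConj L) (Matrix.of fun i j : Fin 2 => if i.val + j.val + 1 = 2 then (1 : L) else 0) (IsCMField.complexConj_ne_one L) w hw γH.1).val : GL (Fin 2) (w.1.adicCompletion L))) : GL (Fin 2) (w.1.adicCompletion L)) : Matrix (Fin 2) (Fin 2) (w.1.adicCompletion L)).trace / 2) • (1 : Matrix (Fin 2) (Fin 2) (w.1.adicCompletion L)))).restrictScalars (Valued.integer (w.1.adicCompletion L))) ≤ scaleLattice (ϖ ^ (2 * (k' + 1))) B ∧ ¬ B.map ((Matrix.toLin' ((((Matrix.GeneralLinearGroup.scalar (Fin 2) s * ((localNonsplitEquiv (IsCMField.complexConj L) (Matrix.of fun i j : Fin 2 => if i.val + j.val + 1 = 2 then (1 : L) else 0) (IsCMField.complexConj_ne_one L) w hw γH.1).val : GL (Fin 2) (w.1.adicCompletion L))) : GL (Fin 2) (w.1.adicCompletion L)) : Matrix (Fin 2) (Fin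 2) (w.1.adicCompletion L)) - ((((Matrix.GeneralLinearGroup.scalar (Fin 2) s * ((localNonsplitEquiv (IsCMField.complexConj L) (Matrix.of fun i j : Fin 2 => if i.val + j.val + 1 = 2 then (1 : L) else 0) (IsCMField.complexConj_ne_one L) w hw γH.1).val : GL (Fin 2) (w.1.adicCompletion L))) : GL (Fin 2) (w.1.adicCompletion L)) : Matrix (Fin 2) (Fin 2) (w.1.adicCompletion L)).trace / 2) • (1 : Matrix (Fin 2) (Fin 2) (w.1.adicCompletion L)))).restrictScalars (Valued.integer (w.1.adicCompletion L))) ≤ scaleLattice (ϖ ^ (m + 1)) B) ∧ ¬ (∃ y₂ ∈ B, ∃ a : (w.1.adicCompletion L), Valued.v a = 1 ∧ Valued.v ((ϖ ^ m)⁻¹ * pairing (galAdicCompletionMap (L := L) (IsCMField.complexConj L) hw) (!![(0 : (w.1.adicCompletion L)), 1; 1, 0] : Matrix (Fin 2) (Fin 2) (w.1.adicCompletion L)) y₂ (((((Matrix.GeneralLinearGroup.scalar (Fin 2) s * ((localNonsplitEquiv (IsCMField.complexConj L) (Matrix.of fun i j : Fin 2 => if i.val + j.val + 1 = 2 then (1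 : L) else 0) (IsCMField.complexConj_ne_one L) w hw γH.1).val : GL (Fin 2) (w.1.adicCompletion L))) : GL (Fin 2) (w.1.adicCompletion L)) : Matrix (Fin 2) (Fin 2) (w.1.adicCompletion L)) - ((((Matrix.GeneralLinearGroup.scalar (Fin 2) s * ((localNonsplitEquiv (IsCMField.complexConj L) (Matrix.of fun i j : Fin 2 => if i.val + j.val + 1 = 2 then (1 : L) else 0) (IsCMField.complexConj_ne_one L) w hw γH.1).val : GL (Fin 2) (w.1.adicCompletion L))) : GL (Fin 2) (w.1.adicCompletion L)) : Matrix (Fin 2) (Fin 2) (w.1.adicCompletion L)).trace / 2) • (1 : Matrix (Fin 2) (Fin 2) (w.1.adicCompletion L))) *ᵥ y₂) - ((ϖ ^ m)⁻¹ * ((((k⁻¹ * (Matrix.GeneralLinearGroup.scalar (Fin 2) s * ((localNonsplitEquiv (IsCMField.complexConj L) (Matrix.of fun i j : Fin 2 => if i.val + j.val + 1 = 2 then (1 : L) else 0) (IsCMField.complexConj_ne_one L) w hw γH.1).val : GL (Fin 2) (w.1.adicCompletion L))) * k) : GL (Fin 2) (w.1.adicCompletion L)) : Matrix (Fin 2)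 (Fin 2) (w.1.adicCompletion L)).trace / 2 - 1)) * a ^ 2) < 1))} := by
    ext B
    simp only [Set.mem_setOf_eq]
    constructor
    · rintro ⟨hSD, hfix, hl, hn, hc⟩; exact ⟨hSD, hfix, ⟨((Set.ext_iff.1 e2 B).1 ⟨hSD, hfix, hl⟩).2.2, hn⟩, hc⟩
    · rintro ⟨hSD, hfix, ⟨hl, hn⟩, hc⟩; exact ⟨hSD, hfix, ((Set.ext_iff.1 e2 B).2 ⟨hSD, hfix, hl⟩).2.2, hn, hc⟩
  rw [hswap2]
  -- (5) pull `s·ĝ_w` back through the one-place model and read p05's centred-shell halves there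
  set γ₂' := (localNonsplitEquiv (IsCMField.complexConj L) (Matrix.of fun i j : Fin 2 => if i.val + j.val + 1 = 2 then (1 : L) else 0) (IsCMField.complexConj_ne_one L) w hw).symm ⟨(Matrix.GeneralLinearGroup.scalar (Fin 2) s * ((localNonsplitEquiv (IsCMField.complexConj L) (Matrix.of fun i j : Fin 2 => if i.val + j.val + 1 = 2 then (1 : L) else 0) (IsCMField.complexConj_ne_one L) w hw γH.1).val : GL (Fin 2) (w.1.adicCompletion L))), hGU⟩ with hγ₂'def
  have hGv : (((localNonsplitEquiv (IsCMField.complexConj L) (Matrix.of fun i j : Fin 2 => if i.val + j.val + 1 = 2 then (1 : L) else 0) (IsCMField.complexConj_ne_one L) w hw) γ₂' : ↥(unitaryGroupOfForm (galAdicCompletionMap (L := L) (IsCMField.complexConj L) hw) (placeForm (Matrix.of fun i j : Fin 2 => if i.val + j.val + 1 = 2 then (1 : L) else 0) w.1))) : GL (Fin 2) (w.1.adicCompletion L)) = (Matrix.GeneralLinearGroup.scalar (Fin 2) s * ((localNonsplitEquiv (IsCMField.complexConj L) (Matrix.of fun i j : Fin 2 => if i.val + j.val + 1 = 2 then (1 :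 L) else 0) (IsCMField.complexConj_ne_one L) w hw γH.1).val : GL (Fin 2) (w.1.adicCompletion L))) := by
    rw [hγ₂'def, ContinuousMulEquiv.apply_symm_apply]
  have hirr' : ¬ ∃ x : (w.1.adicCompletion L), ((((((localNonsplitEquiv (IsCMField.complexConj L) (Matrix.of fun i j : Fin 2 => if i.val + j.val + 1 = 2 then (1 : L) else 0) (IsCMField.complexConj_ne_one L) w hw) γ₂' : ↥(unitaryGroupOfForm (galAdicCompletionMap (L := L) (IsCMField.complexConj L) hw) (placeForm (Matrix.of fun i j : Fin 2 => if i.val + j.val + 1 = 2 then (1 : L) else 0) w.1))) : GL (Fin 2) (w.1.adicCompletion L)) : Matrix (Fin 2) (Fin 2) (w.1.adicCompletion L))).charpoly).IsRoot x := by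
    rw [hGv, coe_scalar_mul_eq_smul]
    rintro ⟨x, hx⟩
    exact forall_not_isRoot_charpoly_smul (Units.ne_zero s) hirrG x hx
  have hN' : Valued.v ((((((localNonsplitEquiv (IsCMField.complexConj L) (Matrix.of fun i j : Fin 2 => if i.val + j.val + 1 = 2 then (1 : L) else 0) (IsCMField.complexConj_ne_one L) w hw) γ₂' : ↥(unitaryGroupOfForm (galAdicCompletionMap (L := L) (IsCMField.complexConj L) hw) (placeForm (Matrix.of fun i j : Fin 2 => if i.val + j.val + 1 = 2 then (1 : L) else 0) w.1))) : GL (Fin 2) (w.1.adicCompletion L)) : Matrix (Fin 2) (Fin 2) (w.1.adicCompletion L))).trace ^ 2 - 4 * (((((localNonsplitEquiv (IsCMField.complexConj L) (Matrix.of fun i j : Fin 2 => if i.val + j.val + 1 = 2 then (1 : L) else 0) (IsCMField.complexConj_ne_one L) w hw) γ₂' : ↥(unitaryGroupOfForm (galAdicCompletionMap (L := L) (IsCMField.complexConj L) hw) (placeForm (Matrix.of fun i j : Fin 2 => if i.val + j.val + 1 = 2 then (1 : L) else 0) w.1))) : GL (Fin 2) (w.1.adicCompletion L)) : Matrix (Fin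 2) (Fin 2) (w.1.adicCompletion L))).det) = WithZero.exp (-((2 * (2 * n + 1) : ℕ) : ℤ)) := by
    rw [hGv]; exact hGN
  have hcD' : Valued.v ((((((localNonsplitEquiv (IsCMField.complexConj L) (Matrix.of fun i j : Fin 2 => if i.val + j.val + 1 = 2 then (1 : L) else 0) (IsCMField.complexConj_ne_one L) w hw) γ₂' : ↥(unitaryGroupOfForm (galAdicCompletionMap (L := L) (IsCMField.complexConj L) hw) (placeForm (Matrix.of fun i j : Fin 2 => if i.val + j.val + 1 = 2 then (1 : L) else 0) w.1))) : GL (Fin 2) (w.1.adicCompletion L)) : Matrix (Fin 2) (Fin 2) (w.1.adicCompletion L))).trace / 2 - 1) ≤ Valued.v (((Units.mk0 ϖ hϖ0 : (w.1.adicCompletion L)ˣ) : (w.1.adicCompletion L)) ^ (2 * (k' + 1) + 1)) := by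
    rw [hGv, coe_scalar_mul_eq_smul, Matrix.trace_smul, smul_eq_mul, mul_div_assoc, v_mul_trace_div_two_sub_one_eq h2w hs hsv, Units.val_mk0,
      show 2 * (k' + 1) + 1 = m by omega]
    exact hscG.le
  have ht0 : Valued.v ((ϖ ^ m)⁻¹ * ((((k⁻¹ * (Matrix.GeneralLinearGroup.scalar (Fin 2) s * ((localNonsplitEquiv (IsCMField.complexConj L) (Matrix.of fun i j : Fin 2 => if i.val + j.val + 1 = 2 then (1 : L) else 0) (IsCMField.complexConj_ne_one L) w hw γH.1).val : GL (Fin 2) (w.1.adicCompletion L))) * k) : GL (Fin 2) (w.1.adicCompletion L)) : Matrix (Fin 2) (Fin 2) (w.1.adicCompletion L)).trace / 2 - 1)) = 1 := by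
    rw [map_mul, map_inv₀, trace_coe_inv_conj_scalar_mul, mul_div_assoc, v_mul_trace_div_two_sub_one_eq h2w hs hsv, hscG,
      inv_mul_cancel₀ ((Valuation.ne_zero_iff _).2 (pow_ne_zero m hϖ0))]
  have e3 := UnitaryGroup.setOf_selfDual_fixed_centredShell_not_class_eq_class_mul_of_odd_depth_ramified L v w hw he h2 (Units.mk0 ϖ hϖ0) hϖ hσϖ γ₂' hN'
    (j := k' + 1) (by omega) hcD' _ ε ht0 hεv hε
  have c := UnitaryGroup.ncard_selfDual_fixed_centredShell_class_eq_pow_of_odd_depth_ramified L v w hw he h2 (Units.mk0 ϖ hϖ0) hϖ hσϖ γ₂' hirr' hN'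
    (j := k' + 1) (by omega) hcD' (((ϖ ^ m)⁻¹ * ((((k⁻¹ * (Matrix.GeneralLinearGroup.scalar (Fin 2) s * ((localNonsplitEquiv (IsCMField.complexConj L) (Matrix.of fun i j : Fin 2 => if i.val + j.val + 1 = 2 then (1 : L) else 0) (IsCMField.complexConj_ne_one L) w hw γH.1).val : GL (Fin 2) (w.1.adicCompletion L))) * k) : GL (Fin 2) (w.1.adicCompletion L)) : Matrix (Fin 2) (Fin 2) (w.1.adicCompletion L)).trace / 2 - 1)) * ε) ε (by rw [map_mul, ht0, hεv, mul_one]) hεv hε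
  rw [hGv] at e3 c
  simp only [Units.val_mk0] at e3 c
  rw [show 2 * (k' + 1 + 1) = m + 1 by omega, show 2 * (k' + 1) + 1 = m by omega] at e3 c
  rw [← stdForm_antidiagonal_two_over_eq, ← placeForm_antidiagOne, e3, c, show n - (k' + 1) = a by omega]

end Literature.NumberTheory.Rogawski1990.BlockLawHyp

end
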